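import Literature.NumberTheory.ConnesConsani2021.SemilocalTwist
import Literature.Analysis.FunctionSpaces.FourierSobolevNormScalingProofs
import Literature.Analysis.FunctionSpaces.PlancherelL1L2
import Mathlib.Analysis.SpecialFunctions.Gaussian.FourierTransform
import Mathlib.NumberTheory.LSeries.MellinEqDirichlet
import Mathlib.NumberTheory.SmoothNumbers
import Mathlib.NumberTheory.Padics.PadicNumbers
import Mathlib.Analysis.SpecialFunctions.Gamma.Deligne
import Mathlib.Analysis.MellinTransform
import HarnessLib

/-!
# Connes–Consani–Moscovici 2024, §4.1–§4.4 and §4.7: the semilocal Hardy–Titchmarsh transform, the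
# semilocal Hermite operator, the dual transform and the stability of Sonin spaces — STATEMENT LAYER

RH-FREE corpus literature (label, l.1): semilocal harmonic analysis of A. Connes, C. Consani,
H. Moscovici, *Zeta zeros and prolate wave operators* (semilocal adelic operators), Ann. Funct. Anal.
15 (2024) = arXiv:2310.18423v2 [bib: `ConnesConsaniMoscovici2024`], §4 "Semilocal case", pp. 16–24
of the arXiv version (held text `paper:arxiv-2310.18423`, tex chunks p0012–p0016).  NO positivity
statement, NO inequality with a prime, nothing here bears on the truth of RH.  WHAT THIS IS NOT: a
construction of `L²(X_S)` or of the semilocal trace formula; a claim about Weil positivity.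

Cell `rh-crit`, corpus C1 (Connes–Consani), seat t13 (typer → prover); one file for the source
SECTION §4.1–4.4 + §4.7 (D-0064).  Statements first: every numbered item is typed with its locator
(arXiv v2 page + tex chunk `pNNNN:Lnn`), PROVED when elementary, otherwise recorded as a named fact
`def ConnesConsaniMoscovici2024_… : Prop` (D-0014; discharged in the same seat's second pass).
Items of §4 that the tree ALREADY holds are CITED, not restated (typer lint rule):
`Literature.NumberTheory.ConnesConsani2021.primeTwist` (= `θ_S`, Prop. 4.6 (ii) / eq. (57)),
`semilocalSoninSpace` (Def. 4.5), `semilocalFourier` (`𝔽_S`, pulled back), `primeTwistEquiv`,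
`mem_semilocalSoninSpace_iff_vanish` (Def. 4.5 ⟺ Thm. 4.6), `SemilocalTwist` (§4.8's twisted inner
product); `Literature.NumberTheory.ConnesConsani2024.SemilocalClassSpace p q` (the space `X_S` for
`S = {p, q, ∞}`, Knots & primes Prop. 3.1); `Literature.NumberTheory.Connes2026.sIntegers`/`sUnits`/
`SemilocalAdele`/`adeleClassSpace`/`ideleClassGroup`/`modAdele`/`kerMod`/`cutoffProj`/`semilocalFourierOf`
(`LetterSemilocal.lean`: the §4.1 objects `ℚ_S`, `Γ`, `𝔸_S`, `X_S`, `C_S`, `Mod_S`, `K_S`, the cutoff `P_Λ`, and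
`𝔽_S` for general finite `S`, `semilocalFourierOf {p} = semilocalFourier p`).

## Printed numbering (arXiv v2; the tex chunks drop the word "Proposition")

§4.1 Notations p. 16 (eqs. (36)–(43)); §4.2 "Semilocal Hardy–Titchmarsh transform" pp. 16–18:
eq. (44) `η_S`, (45)–(46) `ℰ_S`, **Proposition 4.1** (chunk p0012:L96 "11.") with eq. (47), eq. (48)
`ℳ_S, dm_S`, **Proposition 4.2** (p0013:L1 "12.") canonical form of `(ϑ_S, ξ_S)`, **Proposition 4.3**
(p0013:L19 "13.") with diagram (49); §4.3 "Semilocal Hermite operator" pp. 18–19: **Theorem 4.1**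
(p0013:L43), the candidate `W_{λ,S} = (H + ½)² + λ²N_S` (unnumbered display, p. 19), **Remark 4.2**
(p0013:L61) with eq. (50); §4.4 "The dual transform" pp. 19–20: eq. (51) `E_S`, (52) `β_S`,
**Definition 4.3** (p0013:L97; v2: "dual Hardy–Titchmarsh transform") eq. (53), **Proposition 4.4**
(p0013:L103 "14.") eq. (54); §4.5: **Definition 4.4** (p0014:L15) local Sonin space, Proposition 4.5
(p0014:L35 "15.", `σ_p`; NOT typed here, see below); §4.6: Definition 4.5 / Proposition 4.6 (TREE);
§4.7 "The stability of Sonin spaces" pp. 22–23: eq. (58), **Proposition 4.7** (p0015:L40 "17.") with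
diagram (59), Theorem 4.6 (TREE); §4.8 Proposition 4.8 (TREE, `SemilocalTwist`).

## How §4 is typed: the pull-back to `L²(ℝ)` (tree convention of `SemilocalSoninSpace.lean`)

The Hilbert space of §4 is `L²(X_S)^{K_S}`, `X_S = 𝔸_S/Γ`.  The unitary `w_S : L²(X_S) → L²(C_S)`
([CMbook] Prop. 2.30, eq. (42)) identifies `K_S`-invariants with functions of the module, i.e. with
`L²(ℝ₊*, d*u) ≅ L²(ℝ)_ev` via `w_∞(f)(u) = u^{1/2}f(u)` (§3.1.2, eq. (18)).  Under this identification
`U : L²(ℝ)_ev ≅ L²(X_S)^{K_S}` the printed maps become (for `S = {∞, p}`, the case typed here for all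
OPERATORS — TODO(general form): finite commuting products over the primes of `S`):
* `η_S` (eq. (44), class of `1_{R_S} ⊗ f`) ↦ `η_p := Σ_{k ≥ 0} D_{p^k} = (1 − D_p)⁻¹`
  (`semilocalEta`), `(D_a f)(x) = f(ax)` the tree's `lpDilation`; indeed eq. (45)–(46):
  `w_S(η_S f)(u) = u^{1/2} Σ_{n ∈ Γ_+ ∩ ℤ} f(nu)` and `Γ_+ ∩ ℤ = {p^k}` (general `S`: the `S`-factored
  numbers, Mathlib's `Nat.factoredNumbers`); at function level `primeSum p f u = Σ_k f(p^k u)`;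
* `θ_S` (§4.6) ↦ the tree's `primeTwist p = 1 − p⁻¹D_{p⁻¹}`;
* `𝒰_S = 𝔽_μ ∘ w_S` (§4.2) ↦ `𝔽_μ ∘ w_∞`, and `𝔽_μ(w_∞ f)(s) = ∫₀^∞ f(u)u^{1/2−is}d*u`
  (eqs. (18)–(19)) `= mellin f (1/2 − is)` (Mathlib's `mellin`); we do not introduce a symbol for
  `𝒰` (§3, seat t12) and state Mellin-side identities with `mellin f (1/2 − s I)` directly, on the
  functions for which the Mellin integral converges absolutely (`MellinConvergent`) — the printed
  `L²` statements are the unitary (Mellin–Plancherel) extensions, TODO(general form);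
* `𝔽_S` ↦ the tree's `semilocalFourier p = θ_p ∘ 𝓕 ∘ θ_p⁻¹`; Prop. 4.1 (iii) says equivalently
  `𝔽_S ∘ η_p = η_p ∘ 𝓕` (PROVED below; the two descriptions agree because `𝓕 D_a = |a|⁻¹D_{a⁻¹}𝓕`);
* the scaling group `ϑ(λ)` ↦ the tree's unitary dilations (`lpDilation`, CC 2021 eq. (40)); its
  generator `ϑ_S = −i(x∂_x + ½)` (§3.2) is unbounded and is only used here through its action on
  Gaussian-polynomial vectors (`scalingGenPoly`, §4.3).
The purely algebraic objects of §4.1 (`ℚ_S`, `Γ = ℚ_S^*`, `𝔸_S`, `X_S`, `C_S`, `Mod_S`, `K_S`) are those of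
Connes' Letter §7.3–7.4, typed for a general finite set of primes in `Connes2026/LetterSemilocal.lean` — CITED.

## What is typed, item by item (P = proved here, F = named fact, D = definition, C = cited)

§4.1: (36)–(41), (43) C (`Connes2026.sIntegers`, `sUnits`, `SemilocalAdele`, `adeleClassSpace`,
`ideleClassGroup`, `modAdele`, `kerMod`; `w_S` (42) is constructed nowhere — no Haar/`L²` on `𝔸_S/Γ`);
`Γ_+ ∩ ℤ =` S-factored numbers (`mem_factoredNumbers_iff_padicValRat_eq_zero`) P.
§4.2: `primeSum` (44)–(46) D, `eulerFactor` `L_p` D (`L_∞ = Complex.Gammaℝ`, Mathlib), `primeDilation`,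
`semilocalEta` D + Neumann-series lemmas P, `vanishSet`/`cutoffSpace` `P_λ` D (= fixed space of
`Connes2026.cutoffProj`, C); Prop. 4.1 (i) F+P (`ConnesConsaniMoscovici2024_prop_4_1_i`, discharged:
`…_holds`, via `integral_tsum` + `mellin_comp_mul_left` + geometric series), (ii) P (`semilocalEta_mem_cutoffSpace`), (iii) P
(`semilocalFourier_semilocalEta`: `𝔽_S η_p = η_p 𝓕`, via the `L²` dilation law `fourier_lpDilation`), (iv) P
(`semilocalEta_fourier_mem_semilocalFourier_cutoffSpace`); `semilocalMultiplier`, `semilocalM`, `semilocalDensity`,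
`semilocalMeasure` (48) D, `semilocalV` `𝒱_S` D; Prop. 4.2: `gaussianVec` `ξ_∞ = h₀` D, `semilocalXi` `ξ_S` D, the Mellin
identity of its proof P (`mellin_primeSum_gaussianFun`: `𝒰(η_p h₀) = 2^{−3/4}L_pL_∞`), grading (ii) P
(`semilocalFourier_semilocalXi`: `𝔽_S ξ_S = ξ_S` via `𝓕h₀ = h₀` in `L²`; `semilocalFourier_lpDilation`:
`𝔽_S ϑ(λ) = ϑ(λ⁻¹) 𝔽_S`);
the "canonical form" clause itself is Thm. 2.1 / Prop. 3.1 bookkeeping (§2–§3, seat t12) and is not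
restated; Prop. 4.3 (i) P as the two-sided bound on `|L_p(½ ∓ is)|` (`norm_eulerFactor_le`,
`le_norm_eulerFactor`: `norm_eulerFactor_bounds`) + `semilocalEtaEquiv` (η bounded with bounded inverse),
(ii) P (`semilocalV_primeSum`).
§4.3: `gaussMonomialFun`/`gaussMonomialVec`/`gaussComb` D, `archFiltration` `E_n` D, `semilocalFiltration`
`E_n^S` D, `semilocalLayer` (eigenspaces of `N_S`) D, `scalingGenCoeff` (`ϑ` on Gaussian polynomials) D;
Thm. 4.1 (i) = Prop. 3.2 (§3.3, seat t12, C — not restated), (ii) F+P (`ConnesConsaniMoscovici2024_thm_4_1_ii`,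
discharged `…_holds`: Gram–Schmidt in `E_n^S`), (iii) F+P (`ConnesConsaniMoscovici2024_thm_4_1_iii`, discharged
`…_holds`: `ϑ_S` symmetric on the core `η_p(ℂ[x²]e^{−πx²})` via the Gaussian moment recursion, real Gram matrix — this
file now holds NO unproved named fact); Rem. 4.2 (iii) eq. (50) P (`exists_primeSum_sq_mul_ne`);
Rem. 4.2 (i)–(ii) and the display `W_{λ,S}` are remarks/"guesses" (programme sentences) — docstrings only.
§4.4: `dualMultiplier` `E_S` (51) D, `betaMul` (52) D, `dualMeasure` D, Def. 4.3 `dualTransform` `υ_S` (53) D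
(function level); Prop. 4.4 (i) P (`dualPairing_integrable`), (ii) P as `conj_semilocalMultiplier` +
`dualTransform_mul_conj_semilocalV` (the printed proof: `conj L_v(½+is) = L_v(½−is)`), the value `⟨ξ|η⟩`
itself being the unitarity of `𝒰` (§3, not asserted).
§4.5: Def. 4.4 for `K = ℝ` D (`localSoninSpace`) + its relation to CC 2021's even Sonin space P; for
`K = ℚ_p` (and Prop. 4.5, `σ_p`) NOT typed: no `L²(ℚ_p)`/`p`-adic Fourier transform in Mathlib — SAID SO.
Related tree declarations over the same `X_S`, not used in §4: the geometric side of Connes' semilocal trace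
formula `Literature.NumberTheory.ConnesConsani.connesSemilocalGeometricSide` (Connes 1999 Thm. VII.4).
§4.7: eq. (58) P (`mellin_primeTwistFun`), Prop. 4.7 (i) P (`semilocalFourier_primeTwist`), (ii) P
(function level, `dualTransform_primeTwistFun`), (iii) P (`inner_primeTwist_semilocalEta`:
`⟪θ_p f, η_p g⟫ = ⟪f, g⟫`, i.e. `θ_p* = η_p⁻¹`).

## References

* A. Connes, C. Consani, H. Moscovici, *Zeta zeros and prolate wave operators*, Ann. Funct. Anal. 15
  (2024) 87, doi:10.1007/s43034-024-00388-z, arXiv:2310.18423v2. [ConnesConsaniMoscovici2024]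
* A. Connes, M. Marcolli, *Noncommutative Geometry, Quantum Fields and Motives*, AMS Coll. Publ. 55
  (2008), Ch. 2 Prop. 2.30 (the unitary `w_S`). [cited by the source as [CMbook]]
-/

noncomputable section

open _root_.MeasureTheory Complex Set Filter FourierTransform
open scoped Real ComplexConjugate ENNReal InnerProductSpace Topology

namespace Literature.NumberTheory.ConnesConsani2024

open Literature.NumberTheory.LFunctions Literature.Analysis.OperatorTheory
open Literature.NumberTheory.ConnesConsani2021

/-! ## §4.1 Notations (p. 16): `ℚ_S`, `Γ = ℚ_S^*`, `X_S`, `C_S`, `Mod_S`, `K_S` — CITED from the tree; `Γ_+ ∩ ℤ`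

The objects of §4.1 coincide with those of Connes' Letter §7.3–7.4 / Connes 1999 §VII, ALREADY typed in
`Literature/NumberTheory/Connes2026/LetterSemilocal.lean` (seat rh-crit O1, landed 2026-08-26); they are
CITED, not restated (typer lint rule):
* eq. (37) `ℚ_S = {q ∈ ℚ | |q|_v ≤ 1 ∀ v ∉ S}` ↦ `Literature.NumberTheory.Connes2026.sIntegers` (`ℤ_S`, same
  ring: `v_ℓ(q) ≥ 0` for primes `ℓ ∉ S`);
* eq. (38) `Γ := ℚ_S^* = GL₁(ℚ_S) = {±p₁^{n₁}⋯p_k^{n_k}}` ↦ `Connes2026.sUnits` (`Γ_S`; `Γ_S = ℤ_S^×`: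
  `mem_sUnits_iff_mem_sIntegers`; explicit form (38): `val_eq_sign_mul_prod_of_mem_sUnits`);
* eq. (36) `𝔸_S = Π_{v∈S} ℚ_v` ↦ `Connes2026.SemilocalAdele`, eq. (39) `X_S = 𝔸_S/Γ` ↦ `Connes2026.adeleClassSpace`,
  eq. (41) `C_S = GL₁(𝔸_S)/Γ` ↦ `Connes2026.ideleClassGroup`, eqs. (40)/(43) `|·|_S`, `Mod_S` ↦
  `Connes2026.modAdele`/`modIdele`/`modClass` (product formula on `Γ`: `modAdele_diag_eq_one` — the sentence
  "The module `|x|` is equal to `1` on principal ideles and hence on elements `γ ∈ Γ`" of the proof of Prop. 4.1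
  (ii)), `K_S = ker Mod_S` ↦ `Connes2026.kerMod`, `C_S ≅ ℝ₊* × K_S` ↦ `existsUnique_archSection_mul_kerMod`;
  for `S = {p, q, ∞}` also `ConnesConsani2024.SemilocalClassSpace` (Knots & primes);
* eq. (42) `w_S : L²(X_S) → L²(C_S)` ([CMbook] Prop. 2.30) is NOT constructed anywhere (no Haar/`L²` on the
  quotient); all analysis below is pulled back to `L²(ℝ)` (module docstring).
New here: the index set `Γ_+ ∩ ℤ` of the sums (44)–(46) is the set of `S`-factored numbers. -/

section Notations

/-- **`Γ_+ ∩ ℤ`** (the index set of the sums (44)–(46)) **is the set of `S`-factored numbers**: a positive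
integer `m` is an `S`-unit — `v_ℓ(m) = 0` for every prime `ℓ ∉ S`, i.e. `m ∈ Γ = Γ_S` (tree:
`Literature.NumberTheory.Connes2026.mem_sUnits_iff`, the defining condition of `Connes2026.sUnits ↑S`) — iff all
its prime factors lie in `S`, Mathlib's `Nat.factoredNumbers S` (`= {p₁^{n₁}⋯p_k^{n_k} : n_j ≥ 0}`; for `S = {p}`:
the powers `p^k`).  Stated on the valuation condition so that this file does not depend on `LetterSemilocal`'s
import closure. [cite: ConnesConsaniMoscovici2024, §4.2 eqs. (44)–(46) pp. 16–17 (arXiv chunk p0012:L72–L94)] -/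
theorem mem_factoredNumbers_iff_padicValRat_eq_zero {S : Finset ℕ} {m : ℕ} (hm : m ≠ 0) :
    m ∈ Nat.factoredNumbers S ↔ ∀ ℓ : ℕ, ℓ.Prime → ℓ ∉ S → padicValRat ℓ (m : ℚ) = 0 := by
  rw [Nat.mem_factoredNumbers']
  simp only [padicValRat.of_nat, Nat.cast_eq_zero]
  constructor
  · intro h ℓ hℓ hℓS
    rw [padicValNat.eq_zero_iff]
    exact Or.inr (Or.inr fun hℓm => hℓS (h ℓ hℓ hℓm))
  · intro h ℓ hℓ hℓm
    by_contra hℓS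
    have h0 := h ℓ hℓ hℓS
    rw [padicValNat.eq_zero_iff] at h0
    rcases h0 with h1 | h0 | hdvd
    · exact hℓ.one_lt.ne' h1
    · exact hm h0
    · exact hdvd hℓm

end Notations

/-! ## §4.2 The semilocal Hardy–Titchmarsh transform (pp. 16–18), `S = {∞, p}` pulled back to `L²(ℝ)` -/

section Transform

/-- **`η_S` at function level**, `S = {∞, p}`: `η_S(f)(1 × u) = Σ_{γ ∈ Γ_+ ∩ ℤ} f(γu) = Σ_{k ≥ 0} f(p^k u)`
(display after eq. (44); for general `S` the sum runs over the `S`-factored numbers,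
`mem_factoredNumbers_iff_padicValRat_eq_zero`),
so that `w_S(η_S(f))(u) = ℰ_S(f)(u) = u^{1/2} · primeSum p f u` (eqs. (45)–(46)).
TODO(general form): `Σ_{n ∈ Nat.factoredNumbers S} f(nu)`.
[cite: ConnesConsaniMoscovici2024, §4.2 eqs. (44)–(46) pp. 16–17 (arXiv chunk p0012:L74–L94)] -/
def primeSum (p : ℕ) (f : ℝ → ℂ) (u : ℝ) : ℂ :=
  ∑' k : ℕ, f ((p : ℝ) ^ k * u)

/-- **`ℰ_S(f)(u) := u^{1/2} Σ_{Γ_+ ∩ ℤ} f(γu)`** (eq. (46)), `S = {∞, p}`, `u > 0`.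
[cite: ConnesConsaniMoscovici2024, §4.2 eq. (46) p. 17 (arXiv chunk p0012:L93)] -/
def semilocalE (p : ℕ) (f : ℝ → ℂ) (u : ℝ) : ℂ :=
  ((u : ℂ) ^ ((1 / 2 : ℂ))) * primeSum p f u

/-- **The local Euler factor `L_p(z) := (1 − p^{−z})⁻¹`** ("with `L_p(z) = (1 − p^{−z})⁻¹` for `z ∈ ℂ`",
Prop. 4.1); the archimedean factor `L_∞(z) = π^{−z/2}Γ(z/2)` (Thm. 3.1 (i)) is Mathlib's `Complex.Gammaℝ`.
[cite: ConnesConsaniMoscovici2024, Prop. 4.1 §4.2 p. 17 (arXiv chunk p0012:L96)] -/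
def eulerFactor (p : ℕ) (z : ℂ) : ℂ :=
  (1 - (p : ℂ) ^ (-z))⁻¹

/-- **Proposition 4.1 (i)** (eq. (47)), `S = {∞, p}`, on the Mellin side: "`𝔽_μ(ℰ_S(f))(s) =
(Π_{p ∈ S∖{∞}} L_p(½ − is)) (𝔽_μ w_∞ f)(s)`".  With `𝔽_μ(w_∞ g)(s) = ∫₀^∞ g(u)u^{1/2−is}d*u =
mellin g (½ − is)` (eqs. (18)–(19)) and `𝔽_μ(ℰ_S f) = 𝔽_μ(w_∞(primeSum p f))`, the printed identity reads
`mellin (primeSum p f) (½ − is) = L_p(½ − is) · mellin f (½ − is)`.  Printed for `f ∈ L²(ℝ)^{ev}` with the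
unitary `𝔽_μ`; typed on the functions whose Mellin integral converges absolutely on the critical line (the
printed proof is the termwise computation `∫₀^∞ f(p^k u)u^{½−is}d*u = p^{−k/2}p^{iks}∫₀^∞ f(v)v^{½−is}d*v`
summed as a geometric series) — TODO(general form): the `L²` statement by Mellin–Plancherel.  DISCHARGED below
(`ConnesConsaniMoscovici2024_prop_4_1_i_holds`).  RH-FREE. [cite: ConnesConsaniMoscovici2024, Prop. 4.1 (i) eq. (47) §4.2 p. 17 (arXiv chunk p0012:L98–L121)] -/
def ConnesConsaniMoscovici2024_prop_4_1_i (p : ℕ) [Fact p.Prime] : Prop :=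
  ∀ (f : ℝ → ℂ) (s : ℝ), MellinConvergent f (1 / 2 - s * I) →
    mellin (primeSum p f) (1 / 2 - s * I) =
      eulerFactor p (1 / 2 - s * I) * mellin f (1 / 2 - s * I)

variable (p : ℕ) [hp : Fact p.Prime]

/-- `‖p^{−z}‖ = p^{−1/2} < 1` on the critical line. [cite: ConnesConsaniMoscovici2024, proof of Prop. 4.1 (i) §4.2 p. 17 (arXiv chunk p0012:L121)] -/
theorem norm_prime_cpow_neg_lt_one (s : ℝ) : ‖(p : ℂ) ^ (-(1 / 2 - s * I))‖ < 1 := by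
  have hp1 : 1 < p := hp.out.one_lt
  have hp0 : (0 : ℝ) < p := by exact_mod_cast hp.out.pos
  rw [Complex.norm_natCast_cpow_of_pos hp.out.pos]
  simp only [neg_sub, sub_re, mul_re, ofReal_re, I_re, mul_zero, ofReal_im, I_im, mul_one,
    sub_self, one_div]
  rw [show (0 : ℝ) - (2 : ℂ)⁻¹.re = -(1 / 2) by norm_num]
  exact Real.rpow_lt_one_of_one_lt_of_neg (by exact_mod_cast hp1) (by norm_num)

omit hp in
/-- `((p^k : ℝ) : ℂ)^{−z} = (p^{−z})^k`. [folklore] -/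
private theorem natCast_pow_cpow_neg (k : ℕ) (z : ℂ) :
    (((p : ℝ) ^ k : ℝ) : ℂ) ^ (-z) = ((p : ℂ) ^ (-z)) ^ k := by
  rw [Complex.ofReal_pow, Complex.ofReal_natCast,
    ← Complex.cpow_nat_mul' (by rw [Complex.natCast_arg]; simp [Real.pi_pos])
      (by rw [Complex.natCast_arg]; simp [Real.pi_pos.le]),
    Complex.cpow_nat_mul]

/-- **Proposition 4.1 (i) discharged**: for `f` with absolutely convergent Mellin integral on the critical
line, `mellin (Σ_k f(p^k ·)) (½ − is) = L_p(½ − is) · mellin f (½ − is)` — the printed termwise computation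
`∫₀^∞ f(p^ku)u^{½−is}d*u = p^{−k/2}p^{iks}∫₀^∞ f(v)v^{½−is}d*v` summed as a geometric series, with the
interchange of sum and integral justified by `Σ_k ∫|u^{−½−is}f(p^ku)|du = Σ_k p^{−k/2}·∫|u^{−½}f(u)|du < ∞`.
RH-FREE. [cite: ConnesConsaniMoscovici2024, Prop. 4.1 (i) eq. (47) §4.2 p. 17 (arXiv chunk p0012:L98–L121)] -/
theorem ConnesConsaniMoscovici2024_prop_4_1_i_holds : ConnesConsaniMoscovici2024_prop_4_1_i p := by
  intro f s hf
  have hp0 : (0 : ℝ) < p := by exact_mod_cast hp.out.pos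
  have hp1 : (1 : ℝ) < p := by exact_mod_cast hp.out.one_lt
  set z : ℂ := 1 / 2 - s * I with hz
  have hzre : z.re = 1 / 2 := by simp [hz]
  -- the terms `G k t = t^{z-1} f(p^k t)` and the reference integrand `H t = ‖t^{z-1} f t‖`
  set G : ℕ → ℝ → ℂ := fun k t => ((t : ℝ) : ℂ) ^ (z - 1) • f ((p : ℝ) ^ k * t) with hG
  set H : ℝ → ℝ := fun u => ‖((u : ℝ) : ℂ) ^ (z - 1) • f u‖ with hH
  have hGi : ∀ k, IntegrableOn (G k) (Ioi 0) := fun k =>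
    (MellinConvergent.comp_mul_left (pow_pos hp0 k)).2 hf
  -- the integral of each term
  have hGint : ∀ k, ∫ t in Ioi 0, G k t = ((p : ℂ) ^ (-z)) ^ k * mellin f z := by
    intro k
    have h := mellin_comp_mul_left f z (pow_pos hp0 k)
    rw [smul_eq_mul, natCast_pow_cpow_neg] at h
    exact h
  -- the integral of the norm of each term: `∫‖G k‖ = (p^k)^{-1/2} ∫ H`
  have hGnorm : ∀ k, ∫ t in Ioi 0, ‖G k t‖ = ((p : ℝ) ^ (-(1 / 2) : ℝ)) ^ k * ∫ u in Ioi 0, H u := by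
    intro k
    have ha0 : 0 < (p : ℝ) ^ k := pow_pos hp0 k
    have hpt : ∀ t ∈ Ioi (0 : ℝ), ‖G k t‖ = ((p : ℝ) ^ k) ^ (1 / 2 : ℝ) * H ((p : ℝ) ^ k * t) := by
      intro t ht
      have ht0 : (0 : ℝ) < t := ht
      simp only [hG, hH, norm_smul, Complex.norm_cpow_eq_rpow_re_of_pos ht0,
        Complex.norm_cpow_eq_rpow_re_of_pos (mul_pos ha0 ht0), sub_re, one_re, hzre]
      rw [Real.mul_rpow ha0.le ht0.le, ← mul_assoc, ← mul_assoc, ← Real.rpow_add ha0,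
        show (1 / 2 + (1 / 2 - 1) : ℝ) = 0 by norm_num, Real.rpow_zero, one_mul]
    rw [setIntegral_congr_fun measurableSet_Ioi hpt, integral_const_mul,
      integral_comp_mul_left_Ioi H 0 ha0, mul_zero, smul_eq_mul, ← mul_assoc]
    congr 1
    rw [← Real.rpow_neg_one, ← Real.rpow_add ha0, ← Real.rpow_natCast (p : ℝ) k,
      ← Real.rpow_mul hp0.le, ← Real.rpow_natCast ((p : ℝ) ^ (-(1 / 2) : ℝ)) k, ← Real.rpow_mul hp0.le]
    congr 1
    ring
  -- summability of the norms
  have hsum : Summable fun k => ∫ t in Ioi 0, ‖G k t‖ := by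
    simp_rw [hGnorm]
    exact (summable_geometric_of_lt_one (by positivity)
      (Real.rpow_lt_one_of_one_lt_of_neg hp1 (by norm_num))).mul_right _
  -- interchange of sum and integral
  have hswap := integral_tsum_of_summable_integral_norm (μ := volume.restrict (Ioi (0 : ℝ))) hGi hsum
  -- pointwise: `Σ_k G k t = t^{z-1} · primeSum p f t`
  have hpt : (fun t : ℝ => ∑' k, G k t) = fun t : ℝ => ((t : ℝ) : ℂ) ^ (z - 1) • primeSum p f t := by
    funext t
    simp only [hG, primeSum, smul_eq_mul]
    exact tsum_mul_left
  rw [hpt] at hswap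
  -- assemble
  have hgeo : ∑' k : ℕ, ((p : ℂ) ^ (-z)) ^ k = (1 - (p : ℂ) ^ (-z))⁻¹ :=
    tsum_geometric_of_norm_lt_one (norm_prime_cpow_neg_lt_one p s)
  calc mellin (primeSum p f) z = ∫ t in Ioi 0, ((t : ℝ) : ℂ) ^ (z - 1) • primeSum p f t := rfl
    _ = ∑' k, ∫ t in Ioi 0, G k t := hswap.symm
    _ = ∑' k, ((p : ℂ) ^ (-z)) ^ k * mellin f z := tsum_congr hGint
    _ = (∑' k : ℕ, ((p : ℂ) ^ (-z)) ^ k) * mellin f z := tsum_mul_right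
    _ = eulerFactor p z * mellin f z := by rw [hgeo, eulerFactor]

/-- `(p : ℝ) ≠ 0` for a prime `p`. [folklore] -/
private theorem prime_cast_ne_zero : ((p : ℝ)) ≠ 0 := Nat.cast_ne_zero.mpr hp.out.ne_zero

/-- **The dilation `D_p`, `(D_p f)(x) = f(px)`** on `L²(ℝ)` — the `k = 1` term of `η_S` (eq. (44)); the tree's
`lpDilation` at scale `p`.  `η_p = Σ_k D_p^k`, `D_p^k = D_{p^k}`.
[cite: ConnesConsaniMoscovici2024, §4.2 eq. (44) p. 16 (arXiv chunk p0012:L74)] -/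
def primeDilation : Lp ℂ 2 (volume : Measure ℝ) →L[ℂ] Lp ℂ 2 (volume : Measure ℝ) :=
  lpDilation (V := ℝ) (F := ℂ) (p := (2 : ℝ≥0∞)) (p : ℝ) (prime_cast_ne_zero p) ENNReal.ofNat_ne_top

/-- `D_p f = f(p ·)` a.e. [cite: ConnesConsaniMoscovici2024, §4.2 eq. (44) p. 16 (arXiv chunk p0012:L74)] -/
theorem primeDilation_coeFn (ξ : Lp ℂ 2 (volume : Measure ℝ)) :
    (primeDilation p ξ : ℝ → ℂ) =ᵐ[volume] fun x => (ξ : ℝ → ℂ) ((p : ℝ) * x) := by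
  have h := lpDilation_coeFn (V := ℝ) (F := ℂ) (p := (2 : ℝ≥0∞)) (prime_cast_ne_zero p)
    ENNReal.ofNat_ne_top ξ
  unfold primeDilation
  simpa only [smul_eq_mul] using h

/-- **`‖D_p f‖₂ = p^{−1/2}‖f‖₂`** — the `L²` scaling law; this is why `η_S` is bounded but NOT unitary
("Since `η_S` is not unitary …", proof of Thm. 4.1 (ii)). [cite: ConnesConsaniMoscovici2024, proof of Thm. 4.1 (ii) §4.3 p. 18 (arXiv chunk p0013:L52)] -/
theorem norm_primeDilation_apply (ξ : Lp ℂ 2 (volume : Measure ℝ)) :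
    ‖primeDilation p ξ‖ = (Real.sqrt p)⁻¹ * ‖ξ‖ := by
  unfold primeDilation
  rw [norm_lpDilation_apply]
  congr 1
  have hp0 : (0 : ℝ) < p := by exact_mod_cast hp.out.pos
  rw [Module.finrank_self, pow_one, abs_of_nonneg (inv_nonneg.2 hp0.le),
    show (1 / (2 : ℝ≥0∞)).toReal = (1 / 2 : ℝ) by simp, ← ENNReal.toReal_rpow,
    ENNReal.toReal_ofReal (inv_nonneg.2 hp0.le), Real.inv_rpow hp0.le, Real.sqrt_eq_rpow]

/-- `‖D_p‖ ≤ p^{−1/2} < 1`. [cite: ConnesConsaniMoscovici2024, proof of Thm. 4.1 (ii) §4.3 p. 18 (arXiv chunk p0013:L52)] -/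
theorem norm_primeDilation_lt_one : ‖primeDilation p‖ < 1 := by
  have hp1 : (1 : ℝ) < p := by exact_mod_cast hp.out.one_lt
  have hs : 1 < Real.sqrt p := by
    rw [show (1 : ℝ) = Real.sqrt 1 by simp]
    exact Real.sqrt_lt_sqrt zero_le_one hp1
  refine lt_of_le_of_lt (ContinuousLinearMap.opNorm_le_bound _ (by positivity)
    fun ξ => (norm_primeDilation_apply p ξ).le) ?_
  exact inv_lt_one_of_one_lt₀ hs

/-- **`η_S` pulled back to `L²(ℝ)`, `S = {∞, p}`: `η_p := Σ_{k ≥ 0} D_{p^k} = (1 − D_p)⁻¹`** (Neumann series,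
`‖D_p‖ = p^{−1/2} < 1`), the operator form of eq. (44)/(46) (`w_S(η_S f) = w_∞(Σ_k f(p^k ·))`).  Bounded with
bounded inverse `1 − D_p`, not unitary.  TODO(general form): `Π_{p ∈ S} η_p = Σ_{n S-factored} D_n`.
[cite: ConnesConsaniMoscovici2024, §4.2 eqs. (44)–(46) pp. 16–17 (arXiv chunk p0012:L74–L94)] -/
def semilocalEta : Lp ℂ 2 (volume : Measure ℝ) →L[ℂ] Lp ℂ 2 (volume : Measure ℝ) :=
  ((Units.oneSub (primeDilation p) (norm_primeDilation_lt_one p))⁻¹ :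
    (Lp ℂ 2 (volume : Measure ℝ) →L[ℂ] Lp ℂ 2 (volume : Measure ℝ))ˣ)

/-- `η_p = Σ_k D_p^k` (the Neumann series, i.e. the sum over `Γ_+ ∩ ℤ = {p^k}` of eq. (44)).
[cite: ConnesConsaniMoscovici2024, §4.2 eq. (44) p. 16 (arXiv chunk p0012:L74)] -/
theorem semilocalEta_eq_tsum : semilocalEta p = ∑' k : ℕ, primeDilation p ^ k := rfl

/-- `D_p^k = D_{p^k}` (the terms of `η_S = Σ_{γ ∈ Γ_+ ∩ ℤ} f(γ ·)`, eq. (44)). [cite: ConnesConsaniMoscovici2024, §4.2 eq. (44) p. 16 (arXiv chunk p0012:L74–L81)] -/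
theorem primeDilation_pow (k : ℕ) :
    primeDilation p ^ k =
      lpDilation (V := ℝ) (F := ℂ) (p := (2 : ℝ≥0∞)) ((p : ℝ) ^ k)
        (pow_ne_zero k (prime_cast_ne_zero p)) ENNReal.ofNat_ne_top := by
  induction k with
  | zero =>
    rw [pow_zero]
    have e : ((p : ℝ) ^ 0) = 1 := pow_zero _
    rw [show lpDilation (V := ℝ) (F := ℂ) (p := (2 : ℝ≥0∞)) ((p : ℝ) ^ 0)
        (pow_ne_zero 0 (prime_cast_ne_zero p)) ENNReal.ofNat_ne_top =
        lpDilation (V := ℝ) (F := ℂ) (p := (2 : ℝ≥0∞)) 1 one_ne_zero ENNReal.ofNat_ne_top by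
      congr 1, lpDilation_one]
  | succ k ih =>
    rw [pow_succ, ih, primeDilation, lpDilation_mul]
    congr 1
    ring

/-- The Neumann series converges to `η_p` in operator norm: `HasSum (k ↦ D_p^k) η_p`.
[cite: ConnesConsaniMoscovici2024, §4.2 eq. (44) p. 16 (arXiv chunk p0012:L74)] -/
theorem hasSum_semilocalEta : HasSum (fun k : ℕ => primeDilation p ^ k) (semilocalEta p) := by
  rw [semilocalEta_eq_tsum]
  exact (summable_geometric_of_norm_lt_one (norm_primeDilation_lt_one p)).hasSum

/-- `(1 − D_p) ∘ η_p = 1`. [cite: ConnesConsaniMoscovici2024, §4.2 p. 17 (arXiv chunk p0013:L7)] -/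
theorem one_sub_primeDilation_mul_semilocalEta :
    (1 - primeDilation p) * semilocalEta p = 1 :=
  (Units.oneSub (primeDilation p) (norm_primeDilation_lt_one p)).mul_inv

/-- `η_p ∘ (1 − D_p) = 1`. [cite: ConnesConsaniMoscovici2024, §4.2 p. 17 (arXiv chunk p0013:L7)] -/
theorem semilocalEta_mul_one_sub_primeDilation :
    semilocalEta p * (1 - primeDilation p) = 1 :=
  (Units.oneSub (primeDilation p) (norm_primeDilation_lt_one p)).inv_mul

/-- **`η_p` is a bicontinuous linear isomorphism of `L²(ℝ)`** (inverse `1 − D_p`) — the operator content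
of Prop. 4.3 (i) ("`ι_S` is bounded with bounded inverse") read through the diagram (49)
`𝒱_S ∘ η_S = ι_S ∘ 𝒱`, and of the first step of the proof of Thm. 4.6 ("the map `θ_S … L²(ℝ)^{ev} →
L²(X_S)^{K_S}` is bounded with bounded inverse" — there for `θ_S`, tree: `primeTwistEquiv`).
[cite: ConnesConsaniMoscovici2024, Prop. 4.3 (i) §4.2 p. 18 (arXiv chunk p0013:L21)] -/
def semilocalEtaEquiv : Lp ℂ 2 (volume : Measure ℝ) ≃L[ℂ] Lp ℂ 2 (volume : Measure ℝ) :=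
  ContinuousLinearEquiv.ofUnit
    ((Units.oneSub (primeDilation p) (norm_primeDilation_lt_one p))⁻¹)

/-- `semilocalEtaEquiv` acts as `η_p`. [cite: ConnesConsaniMoscovici2024, Prop. 4.3 (i) §4.2 p. 18 (arXiv chunk p0013:L21)] -/
theorem semilocalEtaEquiv_apply (ξ : Lp ℂ 2 (volume : Measure ℝ)) :
    semilocalEtaEquiv p ξ = semilocalEta p ξ := rfl

/-- `semilocalEtaEquiv⁻¹` acts as `1 − D_p`. [cite: ConnesConsaniMoscovici2024, Prop. 4.3 (i) §4.2 p. 18 (arXiv chunk p0013:L21)] -/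
theorem semilocalEtaEquiv_symm_apply (ξ : Lp ℂ 2 (volume : Measure ℝ)) :
    (semilocalEtaEquiv p).symm ξ = ξ - primeDilation p ξ := rfl

/-- `(1 − D_p)(η_p ξ) = ξ`. [cite: ConnesConsaniMoscovici2024, §4.2 p. 17 (arXiv chunk p0013:L7)] -/
theorem semilocalEta_sub_primeDilation (ξ : Lp ℂ 2 (volume : Measure ℝ)) :
    semilocalEta p ξ - primeDilation p (semilocalEta p ξ) = ξ := by
  have h : ((1 - primeDilation p) * semilocalEta p) ξ = ξ := by
    rw [one_sub_primeDilation_mul_semilocalEta]; rfl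
  exact h

/-- `η_p (u − D_p u) = u`. [cite: ConnesConsaniMoscovici2024, §4.2 p. 17 (arXiv chunk p0013:L7)] -/
theorem semilocalEta_apply_sub_primeDilation (u : Lp ℂ 2 (volume : Measure ℝ)) :
    semilocalEta p (u - primeDilation p u) = u := by
  have h : (semilocalEta p * (1 - primeDilation p)) u = u := by
    rw [semilocalEta_mul_one_sub_primeDilation]; rfl
  exact h

/-! ### The `L²` dilation law of the Fourier transform and the twist `θ_p` (for Prop. 4.1 (iii), Prop. 4.7 (i)) -/

omit hp in
/-- Changing the scale parameter of `lpDilation` along an equality of reals (proof irrelevance). [folklore] -/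
private theorem lpDilation_congr {a b : ℝ} (h : a = b) (ha : a ≠ 0) (hb : b ≠ 0) :
    (lpDilation (V := ℝ) (F := ℂ) (p := (2 : ℝ≥0∞)) a ha ENNReal.ofNat_ne_top :
        Lp ℂ 2 (volume : Measure ℝ) →L[ℂ] Lp ℂ 2 (volume : Measure ℝ)) =
      lpDilation (V := ℝ) (F := ℂ) (p := (2 : ℝ≥0∞)) b hb ENNReal.ofNat_ne_top := by
  subst h
  rfl

omit hp in
/-- The tree's two `L²` dilations agree: `lpDilation c f` is the class of `x ↦ f(cx)`. [folklore] -/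
private theorem lpDilation_eq_toLp {c : ℝ} (hc : c ≠ 0) (f : Lp ℂ 2 (volume : Measure ℝ)) :
    lpDilation (V := ℝ) (F := ℂ) (p := (2 : ℝ≥0∞)) c hc ENNReal.ofNat_ne_top f =
      (Literature.Analysis.FunctionSpaces.memLp_comp_smul_fun (Lp.memLp f) hc).toLp _ := by
  apply Lp.ext
  filter_upwards [lpDilation_coeFn (V := ℝ) (F := ℂ) (p := (2 : ℝ≥0∞)) hc ENNReal.ofNat_ne_top f,
    (Literature.Analysis.FunctionSpaces.memLp_comp_smul_fun (Lp.memLp f) hc).coeFn_toLp] with x h1 h2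
  rw [h1, h2]

omit hp in
/-- **`𝓕 ∘ D_c = |c|⁻¹ D_{c⁻¹} ∘ 𝓕` on `L²(ℝ)`** — the dilation law of the Fourier transform (`d = 1`) in the
tree's `lpDilation` vocabulary (from `Analysis.FunctionSpaces.fourier_toLp_comp_smul`); the content of "the
function `1_{ℤ_p}` is its own Fourier transform" on the Mellin line (`L_p(½ − is) ↔ L_p(½ + is)`).
[cite: ConnesConsaniMoscovici2024, proof of Prop. 4.1 (iii) §4.2 p. 17 (arXiv chunk p0012:L128)] -/
theorem fourier_lpDilation {c : ℝ} (hc : c ≠ 0) (f : Lp ℂ 2 (volume : Measure ℝ)) :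
    (𝓕 (lpDilation (V := ℝ) (F := ℂ) (p := (2 : ℝ≥0∞)) c hc ENNReal.ofNat_ne_top f) :
        Lp ℂ 2 (volume : Measure ℝ)) =
      (|c|⁻¹ : ℝ) • lpDilation (V := ℝ) (F := ℂ) (p := (2 : ℝ≥0∞)) c⁻¹ (inv_ne_zero hc)
        ENNReal.ofNat_ne_top (𝓕 f : Lp ℂ 2 (volume : Measure ℝ)) := by
  rw [lpDilation_eq_toLp hc, Literature.Analysis.FunctionSpaces.fourier_toLp_comp_smul hc f,
    lpDilation_eq_toLp (inv_ne_zero hc), Module.finrank_self, pow_one, abs_inv]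

omit hp in
/-- `𝓕` on `L²(ℝ)` is additive: `𝓕 (a − b) = 𝓕 a − 𝓕 b` (Mathlib's `Lp.fourierTransformₗᵢ`). [folklore] -/
private theorem fourierLp_sub (a b : Lp ℂ 2 (volume : Measure ℝ)) :
    (𝓕 (a - b) : Lp ℂ 2 (volume : Measure ℝ)) = 𝓕 a - 𝓕 b :=
  map_sub (MeasureTheory.Lp.fourierTransformₗᵢ ℝ ℂ) a b

/-- **`θ_p (𝓕 v) = 𝓕 (v − D_p v)`, i.e. `𝓕 ∘ (1 − D_p) = θ_p ∘ 𝓕`** (`𝓕 D_p = p⁻¹D_{p⁻¹}𝓕`).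
[cite: ConnesConsaniMoscovici2024, Prop. 4.1 (iii) §4.2 p. 17 (arXiv chunk p0012:L107)] -/
theorem primeTwist_fourier (v : Lp ℂ 2 (volume : Measure ℝ)) :
    primeTwist p (𝓕 v : Lp ℂ 2 (volume : Measure ℝ)) =
      (𝓕 (v - primeDilation p v) : Lp ℂ 2 (volume : Measure ℝ)) := by
  have hp0 : (0 : ℝ) < p := by exact_mod_cast hp.out.pos
  have hpne : (p : ℝ) ≠ 0 := hp0.ne'
  rw [show (𝓕 (v - primeDilation p v) : Lp ℂ 2 (volume : Measure ℝ)) =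
      𝓕 v - 𝓕 (primeDilation p v) from fourierLp_sub v _]
  unfold primeDilation
  rw [fourier_lpDilation hpne]
  have hθ : ∀ ζ : Lp ℂ 2 (volume : Measure ℝ), primeTwist p ζ = ζ - (p : ℂ)⁻¹ •
      lpDilation (V := ℝ) (F := ℂ) (p := (2 : ℝ≥0∞)) ((p : ℝ)⁻¹) (inv_ne_zero hpne)
        ENNReal.ofNat_ne_top ζ := fun ζ => by
    simp [primeTwist]
  rw [hθ, abs_of_pos hp0, RCLike.real_smul_eq_coe_smul (K := ℂ) ((p : ℝ)⁻¹), RCLike.ofReal_inv,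
    RCLike.ofReal_natCast]

/-- **`𝓕 (θ_p w) = 𝓕 w − D_p(𝓕 w)`, i.e. `𝓕 ∘ θ_p = (1 − D_p) ∘ 𝓕`** (`𝓕 D_{p⁻¹} = pD_p𝓕`).
[cite: ConnesConsaniMoscovici2024, Prop. 4.7 (i) §4.7 p. 22 (arXiv chunk p0015:L42)] -/
theorem fourier_primeTwist (w : Lp ℂ 2 (volume : Measure ℝ)) :
    (𝓕 (primeTwist p w) : Lp ℂ 2 (volume : Measure ℝ)) =
      (𝓕 w : Lp ℂ 2 (volume : Measure ℝ)) - primeDilation p (𝓕 w : Lp ℂ 2 (volume : Measure ℝ)) := by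
  have hp0 : (0 : ℝ) < p := by exact_mod_cast hp.out.pos
  have hpne : (p : ℝ) ≠ 0 := hp0.ne'
  have hθ : primeTwist p w = w - (p : ℂ)⁻¹ •
      lpDilation (V := ℝ) (F := ℂ) (p := (2 : ℝ≥0∞)) ((p : ℝ)⁻¹) (inv_ne_zero hpne)
        ENNReal.ofNat_ne_top w := by
    simp [primeTwist]
  have hD : lpDilation (V := ℝ) (F := ℂ) (p := (2 : ℝ≥0∞)) ((p : ℝ)⁻¹)⁻¹
      (inv_ne_zero (inv_ne_zero hpne)) ENNReal.ofNat_ne_top = primeDilation p := by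
    unfold primeDilation
    exact lpDilation_congr (inv_inv _) _ _
  rw [hθ, fourierLp_sub, FourierTransform.fourier_smul, fourier_lpDilation (inv_ne_zero hpne), hD,
    abs_of_pos (inv_pos.2 hp0), inv_inv, RCLike.real_smul_eq_coe_smul (K := ℂ) (p : ℝ), smul_smul,
    RCLike.ofReal_natCast, inv_mul_cancel₀ (Nat.cast_ne_zero.mpr hp.out.ne_zero : (p : ℂ) ≠ 0), one_smul]

/-- `D_p` commutes with `θ_p` (both are combinations of dilations, `D_aD_b = D_{ba}`).
[cite: ConnesConsaniMoscovici2024, proof of Thm. 4.1 (ii) §4.3 p. 18 ("the scaling operator commutes with `η_S`", arXiv chunk p0013:L52)] -/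
theorem primeDilation_primeTwist_comm (u : Lp ℂ 2 (volume : Measure ℝ)) :
    primeDilation p (primeTwist p u) = primeTwist p (primeDilation p u) := by
  have hp0 : (0 : ℝ) < p := by exact_mod_cast hp.out.pos
  have hpne : (p : ℝ) ≠ 0 := hp0.ne'
  have hθ : ∀ ζ : Lp ℂ 2 (volume : Measure ℝ), primeTwist p ζ = ζ - (p : ℂ)⁻¹ •
      lpDilation (V := ℝ) (F := ℂ) (p := (2 : ℝ≥0∞)) ((p : ℝ)⁻¹) (inv_ne_zero hpne)
        ENNReal.ofNat_ne_top ζ := fun ζ => by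
    simp [primeTwist]
  rw [hθ, hθ, map_sub, map_smul]
  congr 2
  have h3 : primeDilation p * lpDilation (V := ℝ) (F := ℂ) (p := (2 : ℝ≥0∞)) ((p : ℝ)⁻¹)
      (inv_ne_zero hpne) ENNReal.ofNat_ne_top =
      lpDilation (V := ℝ) (F := ℂ) (p := (2 : ℝ≥0∞)) ((p : ℝ)⁻¹) (inv_ne_zero hpne)
        ENNReal.ofNat_ne_top * primeDilation p := by
    unfold primeDilation
    rw [lpDilation_mul, lpDilation_mul]
    exact lpDilation_congr (mul_comm _ _) _ _
  exact congrArg (fun T => T u) h3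

/-! ### `P_λ` and Proposition 4.1 (ii)–(iv) -/

omit hp in
/-- Functions of `L²(ℝ)` vanishing a.e. on a set `B`, as a submodule (the support / vanishing conditions of
Prop. 4.1 (ii) and Def. 4.4). [cite: ConnesConsaniMoscovici2024, Prop. 4.1 (ii) §4.2 p. 17 (arXiv chunk p0012:L104); Def. 4.4 §4.5 p. 20] -/
def vanishSet (B : Set ℝ) : Submodule ℂ (Lp ℂ 2 (volume : Measure ℝ)) where
  carrier := {ξ | ∀ᵐ x : ℝ, x ∈ B → (ξ : ℝ → ℂ) x = 0}
  zero_mem' := by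
    simp only [Set.mem_setOf_eq]
    filter_upwards [Lp.coeFn_zero ℂ 2 (volume : Measure ℝ)] with x hx _
    rw [hx]; rfl
  add_mem' := by
    intro ξ η hξ hη
    simp only [Set.mem_setOf_eq] at hξ hη ⊢
    filter_upwards [Lp.coeFn_add ξ η, hξ, hη] with x hx e1 e2 hxB
    rw [hx, Pi.add_apply, e1 hxB, e2 hxB, add_zero]
  smul_mem' := by
    intro c ξ hξ
    simp only [Set.mem_setOf_eq] at hξ ⊢
    filter_upwards [Lp.coeFn_smul c ξ, hξ] with x hx e1 hxB
    rw [hx, Pi.smul_apply, e1 hxB, smul_zero]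

omit hp in
/-- Membership in `vanishSet B` (the vanishing conditions of Prop. 4.1 (ii) / Def. 4.4). [cite: ConnesConsaniMoscovici2024, Prop. 4.1 (ii) §4.2 p. 17 (arXiv chunk p0012:L104)] -/
theorem mem_vanishSet_iff {B : Set ℝ} {ξ : Lp ℂ 2 (volume : Measure ℝ)} :
    ξ ∈ vanishSet B ↔ ∀ᵐ x : ℝ, x ∈ B → (ξ : ℝ → ℂ) x = 0 :=
  Iff.rfl

omit hp in
/-- `vanishSet B` is closed in `L²` (an `L²`-limit has an a.e.-convergent subsequence) — closedness of `P_λ`,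
`P_λ^S` (Prop. 4.1 (ii)) and of the Sonin conditions (Def. 4.4). [cite: ConnesConsaniMoscovici2024, Prop. 4.1 (ii) §4.2 p. 17 (arXiv chunk p0012:L104)] -/
theorem isClosed_vanishSet (B : Set ℝ) : IsClosed (vanishSet B : Set (Lp ℂ 2 (volume : Measure ℝ))) := by
  refine IsSeqClosed.isClosed fun u ξ hu hlim => ?_
  obtain ⟨φ, -, hae⟩ := (tendstoInMeasure_of_tendsto_Lp hlim).exists_seq_tendsto_ae
  have hall : ∀ᵐ x : ℝ, ∀ i, x ∈ B → (u (φ i) : ℝ → ℂ) x = 0 :=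
    ae_all_iff.2 fun i => hu (φ i)
  show ∀ᵐ x : ℝ, x ∈ B → (ξ : ℝ → ℂ) x = 0
  filter_upwards [hae, hall] with x hx hx' hxB
  exact tendsto_nhds_unique hx (tendsto_const_nhds.congr fun i => (hx' i hxB).symm)

omit hp in
/-- The tree's `vanishOn γ` (CC 2021 / Def. 4.5 dictionary) is `vanishSet [−γ, γ]`. [cite: ConnesConsaniMoscovici2024, Def. 4.5 §4.6 p. 21 (arXiv chunk p0014:L74–L80)] -/
theorem vanishOn_eq_vanishSet (γ : ℝ) : vanishOn γ = vanishSet (Icc (-γ) γ) :=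
  SetLike.ext fun _ => Iff.rfl

omit hp in
/-- **`P_λ`**: "the subspace … of functions with support in `{x | |x| ≤ λ}`" (Prop. 4.1 (ii)), i.e. vanishing
a.e. off `[−λ, λ]`; pulled back, `P_λ^S ⊂ L²(X_S)^{K_S}` is the same condition on the module
(proof of (ii): "`|x|` makes sense on `X_S` … and so does `P_λ^S`").  It is the fixed space of the tree's
cutoff projection `P_Λ` (Connes 1999 VII (12) / Letter §7.1: `Literature.NumberTheory.Connes2026.cutoffProj`, by
`Connes2026.cutoffProj_eq_self_iff` — same a.e. condition).
[cite: ConnesConsaniMoscovici2024, Prop. 4.1 (ii) §4.2 p. 17 (arXiv chunk p0012:L104)] -/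
def cutoffSpace (lam : ℝ) : Submodule ℂ (Lp ℂ 2 (volume : Measure ℝ)) :=
  vanishSet (Icc (-lam) lam)ᶜ

omit hp in
/-- `P_λ` is closed. [cite: ConnesConsaniMoscovici2024, Prop. 4.1 (ii) §4.2 p. 17 (arXiv chunk p0012:L104)] -/
theorem isClosed_cutoffSpace (lam : ℝ) : IsClosed (cutoffSpace lam : Set (Lp ℂ 2 (volume : Measure ℝ))) :=
  isClosed_vanishSet _

/-- `D_p` preserves `P_λ`: if `f = 0` off `[−λ, λ]` then so is `f(p ·)` (`|px| ≥ |x|`) — the support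
computation of the proof of Prop. 4.1 (ii) ("`λ < |x| = |y||u| ≤ |u| ⇒ f(u) = 0`").
[cite: ConnesConsaniMoscovici2024, proof of Prop. 4.1 (ii) §4.2 p. 17 (arXiv chunk p0012:L123–L126)] -/
theorem primeDilation_mem_cutoffSpace {lam : ℝ} {ξ : Lp ℂ 2 (volume : Measure ℝ)}
    (hξ : ξ ∈ cutoffSpace lam) : primeDilation p ξ ∈ cutoffSpace lam := by
  change ∀ᵐ x : ℝ, x ∈ (Icc (-lam) lam)ᶜ → (primeDilation p ξ : ℝ → ℂ) x = 0
  have hξ' : ∀ᵐ x : ℝ, x ∈ (Icc (-lam) lam)ᶜ → (ξ : ℝ → ℂ) x = 0 := hξ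
  have hp1 : (1 : ℝ) ≤ p := by exact_mod_cast hp.out.one_le
  have hdil : ∀ᵐ x : ℝ, (p : ℝ) * x ∈ (Icc (-lam) lam)ᶜ → (ξ : ℝ → ℂ) ((p : ℝ) * x) = 0 := by
    have := (quasiMeasurePreserving_smul' (V := ℝ) (prime_cast_ne_zero p)).ae hξ'
    simpa only [smul_eq_mul] using this
  filter_upwards [primeDilation_coeFn p ξ, hdil] with x hx hzero hxB
  rw [hx]
  apply hzero
  simp only [Set.mem_compl_iff, Set.mem_Icc, not_and_or, not_le] at hxB ⊢
  have hpx : (p : ℝ) * x - x = ((p : ℝ) - 1) * x := by ring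
  rcases le_or_gt 0 x with hx0 | hx0
  · have hle : x ≤ (p : ℝ) * x := by nlinarith
    rcases hxB with h | h
    · right; linarith
    · right; linarith
  · have hle : (p : ℝ) * x ≤ x := by nlinarith
    rcases hxB with h | h
    · left; linarith
    · left; linarith

/-- Powers of `D_p` preserve any submodule `D_p` preserves. [folklore] -/
private theorem primeDilation_pow_mem {V : Submodule ℂ (Lp ℂ 2 (volume : Measure ℝ))}
    (hV : ∀ ξ ∈ V, primeDilation p ξ ∈ V) {ξ : Lp ℂ 2 (volume : Measure ℝ)} (hξ : ξ ∈ V) (n : ℕ) :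
    (primeDilation p ^ n) ξ ∈ V := by
  induction n with
  | zero => simpa using hξ
  | succ n ih =>
    rw [pow_succ']
    exact hV _ ih

/-- `η_p = Σ_k D_p^k` preserves every CLOSED submodule preserved by `D_p` (Neumann series + closedness).
[cite: ConnesConsaniMoscovici2024, proof of Prop. 4.1 (ii) §4.2 p. 17 (arXiv chunk p0012:L123)] -/
theorem semilocalEta_mem_of_mem {V : Submodule ℂ (Lp ℂ 2 (volume : Measure ℝ))}
    (hVc : IsClosed (V : Set (Lp ℂ 2 (volume : Measure ℝ))))
    (hV : ∀ ξ ∈ V, primeDilation p ξ ∈ V) {ξ : Lp ℂ 2 (volume : Measure ℝ)} (hξ : ξ ∈ V) :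
    semilocalEta p ξ ∈ V := by
  have hsum := (hasSum_semilocalEta p).mapL
    (ContinuousLinearMap.apply ℂ (Lp ℂ 2 (volume : Measure ℝ)) ξ)
  simp only [ContinuousLinearMap.apply_apply] at hsum
  exact hVc.mem_of_tendsto hsum.tendsto_sum_nat
    (Eventually.of_forall fun N => V.sum_mem fun n _ => primeDilation_pow_mem p hV hξ n)

/-- **Proposition 4.1 (ii)**, pulled back: "`η_S(P_λ) ⊂ P_λ^S` where `P_λ^S` is the subspace of
`L²(X_S)^{K_S}` of functions with support in `{x | |x| ≤ λ}`" — `η_p` maps `P_λ` into `P_λ`.  PROVED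
(the printed support computation + Neumann series).  RH-FREE.
[cite: ConnesConsaniMoscovici2024, Prop. 4.1 (ii) §4.2 p. 17 (arXiv chunk p0012:L104, proof L123–L126)] -/
theorem semilocalEta_mem_cutoffSpace {lam : ℝ} {ξ : Lp ℂ 2 (volume : Measure ℝ)}
    (hξ : ξ ∈ cutoffSpace lam) : semilocalEta p ξ ∈ cutoffSpace lam :=
  semilocalEta_mem_of_mem p (isClosed_cutoffSpace lam) (fun _ h => primeDilation_mem_cutoffSpace p h) hξ

/-- **Proposition 4.1 (iii)**, pulled back to `L²(ℝ)`, PROVED: "let `𝔽_S`, acting in `L²(X_S)`, be induced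
by the tensor product of the local Fourier transforms (`1_{ℤ_p}` its own Fourier transform). One has
`𝔽_S ∘ η_S = η_S ∘ 𝔽_{e_ℝ}`."  With the tree's pulled-back `𝔽_S = semilocalFourier p = θ_p ∘ 𝓕 ∘ θ_p⁻¹` and
`η_S ↦ η_p`: `semilocalFourier p (η_p ξ) = η_p (𝓕 ξ)` for every `ξ ∈ L²(ℝ)`.  Proof: `𝓕(1 − D_p) = θ_p𝓕` and
`𝓕θ_p = (1 − D_p)𝓕` (dilation law); for `X := θ_p𝓕θ_p⁻¹(η_pξ)`, `(1 − D_p)X = θ_p𝓕(η_pξ) = 𝓕((1 − D_p)η_pξ)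
= 𝓕ξ`, hence `X = η_p(1 − D_p)X = η_p𝓕ξ`.  (Printed proof: "This follows since `1_{R_S}` is its own Fourier
transform.")  This is also the consistency of the tree's definition of `semilocalFourier` with §4.2.  RH-FREE.
[cite: ConnesConsaniMoscovici2024, Prop. 4.1 (iii) §4.2 p. 17 (arXiv chunk p0012:L107–L108, proof L128)] -/
theorem semilocalFourier_semilocalEta (ξ : Lp ℂ 2 (volume : Measure ℝ)) :
    semilocalFourier p (semilocalEta p ξ) = semilocalEta p (𝓕 ξ : Lp ℂ 2 (volume : Measure ℝ)) := by
  set w := (primeTwistEquiv p).symm (semilocalEta p ξ) with hw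
  have hθw : primeTwist p w = semilocalEta p ξ := by
    rw [← primeTwistEquiv_apply, ContinuousLinearEquiv.apply_symm_apply]
  have hX : semilocalFourier p (semilocalEta p ξ) =
      primeTwist p (𝓕 w : Lp ℂ 2 (volume : Measure ℝ)) := semilocalFourier_apply p _
  have hkey : primeTwist p (𝓕 w : Lp ℂ 2 (volume : Measure ℝ)) -
      primeDilation p (primeTwist p (𝓕 w : Lp ℂ 2 (volume : Measure ℝ))) =
        (𝓕 ξ : Lp ℂ 2 (volume : Measure ℝ)) := by
    rw [primeDilation_primeTwist_comm, ← map_sub (primeTwist p), ← fourier_primeTwist, hθw,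
      primeTwist_fourier, semilocalEta_sub_primeDilation]
  rw [hX, ← hkey, semilocalEta_apply_sub_primeDilation]

/-- **Proposition 4.1 (iv)**, pulled back, PROVED: "`η_S(P̂_λ) ⊂ P̂_λ^S` where `P̂_λ`, `P̂_λ^S` are the images
of `P_λ`, `P_λ^S` by the Fourier transform" — `η_p(𝓕 P_λ) ⊆ 𝔽_S(P_λ)`; "(iv) Follows from (ii) and (iii)".
RH-FREE. [cite: ConnesConsaniMoscovici2024, Prop. 4.1 (iv) §4.2 p. 17 (arXiv chunk p0012:L110, proof L128)] -/
theorem semilocalEta_fourier_mem_semilocalFourier_cutoffSpace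
    {lam : ℝ} {ζ : Lp ℂ 2 (volume : Measure ℝ)} (hζ : ζ ∈ cutoffSpace lam) :
    ∃ ζ' ∈ cutoffSpace lam,
      semilocalEta p (𝓕 ζ : Lp ℂ 2 (volume : Measure ℝ)) = semilocalFourier p ζ' :=
  ⟨semilocalEta p ζ, semilocalEta_mem_cutoffSpace p hζ, (semilocalFourier_semilocalEta p ζ).symm⟩

/-! ### `ℳ_S`, `dm_S` (eq. (48)) and Propositions 4.2–4.3 -/

/-- **The multiplier `Π_{v ∈ S} L_v(½ − is)`** of eq. (48), `S = {∞, p}`: `L_∞(½ − is)·L_p(½ − is)` with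
`L_∞ = Complex.Gammaℝ`.  `ℳ_S(f)(s) := (Π_v L_v(½ − is))⁻¹ f(s)`, `dm_S(s) := |Π_v L_v(½ − is)|² ds`.
[cite: ConnesConsaniMoscovici2024, §4.2 eq. (48) p. 18 (arXiv chunk p0012:L133–L135)] -/
def semilocalMultiplier (s : ℝ) : ℂ :=
  Complex.Gammaℝ (1 / 2 - s * I) * eulerFactor p (1 / 2 - s * I)

/-- **`ℳ_S`** (eq. (48)): `ℳ_S(F)(s) := (Π_{v∈S} L_v(½ − is))⁻¹ F(s)`, on functions of `s ∈ ℝ` (the unitary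
`L²(ℝ) → L²(ℝ, dm_S)` by construction of `dm_S`). [cite: ConnesConsaniMoscovici2024, §4.2 eq. (48) p. 18 (arXiv chunk p0012:L131–L135)] -/
def semilocalM (F : ℝ → ℂ) (s : ℝ) : ℂ :=
  (semilocalMultiplier p s)⁻¹ * F s

/-- **The density of `dm_S`**: `|Π_{v ∈ S} L_v(½ − is)|²` (eq. (48)). [cite: ConnesConsaniMoscovici2024, §4.2 eq. (48) p. 18 (arXiv chunk p0012:L134)] -/
def semilocalDensity (s : ℝ) : ℝ :=
  ‖semilocalMultiplier p s‖ ^ 2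

/-- **The measure `dm_S := |Π_{v∈S} L_v(½ − is)|² ds`** on `ℝ` (eq. (48)). [cite: ConnesConsaniMoscovici2024, §4.2 eq. (48) p. 18 (arXiv chunk p0012:L134)] -/
def semilocalMeasure : Measure ℝ :=
  volume.withDensity fun s => ENNReal.ofReal (semilocalDensity p s)

/-- **`𝒱_S := ℳ_S ∘ 𝒰_S`** (Prop. 4.2 (i)) at function level, pulled back: for `f` on `ℝ₊*` (the even function
of `L²(ℝ)^{ev}` restricted to `u > 0`), `𝒱_S(f)(s) = (Π_v L_v(½ − is))⁻¹ · mellin f (½ − is)`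
(`𝒰_S ∘ U = 𝔽_μ ∘ w_∞ = mellin · (½ − is)`).
[cite: ConnesConsaniMoscovici2024, Prop. 4.2 (i) §4.2 p. 18 (arXiv chunk p0013:L3)] -/
def semilocalV (f : ℝ → ℂ) (s : ℝ) : ℂ :=
  semilocalM p (fun s' => mellin f (1 / 2 - s' * I)) s

omit hp in
/-- **`ξ_∞ = h₀`**, "the vector of norm `1` given by `h₀(x) := 2^{1/4} exp(−πx²)`" (§3.2), as a function.
[cite: ConnesConsaniMoscovici2024, §3.2 p. 10 (arXiv chunk p0008:L69–L73); Prop. 4.2 (i) §4.2 p. 18] -/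
def gaussianFun (x : ℝ) : ℂ :=
  (((2 : ℝ) ^ (1 / 4 : ℝ) * Real.exp (-(π * x ^ 2)) : ℝ) : ℂ)

omit hp in
/-- `h₀` is continuous. [cite: ConnesConsaniMoscovici2024, §3.2 p. 10 (arXiv chunk p0008:L69–L73)] -/
theorem continuous_gaussianFun : Continuous gaussianFun := by
  unfold gaussianFun
  fun_prop

omit hp in
/-- `h₀ ∈ L²(ℝ)` (`|h₀|² = √2 e^{−2πx²}` is integrable). [cite: ConnesConsaniMoscovici2024, §3.2 p. 10 (arXiv chunk p0008:L69)] -/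
theorem memLp_gaussianFun : MemLp gaussianFun 2 (volume : Measure ℝ) := by
  rw [memLp_two_iff_integrable_sq_norm continuous_gaussianFun.aestronglyMeasurable]
  have hint : Integrable (fun x : ℝ => (2 : ℝ) ^ (1 / 2 : ℝ) * Real.exp (-(2 * π) * x ^ 2)) :=
    (integrable_exp_neg_mul_sq (by positivity)).const_mul _
  refine hint.congr (Eventually.of_forall fun x => ?_)
  simp only [gaussianFun, Complex.norm_real, Real.norm_eq_abs]
  rw [abs_of_nonneg (by positivity), mul_pow, ← Real.rpow_natCast ((2 : ℝ) ^ (1 / 4 : ℝ)) 2,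
    ← Real.rpow_mul (by norm_num : (0 : ℝ) ≤ 2), ← Real.exp_nat_mul]
  norm_num
  ring_nf

omit hp in
/-- **`ξ_∞ = h₀ ∈ L²(ℝ)`** as a vector. [cite: ConnesConsaniMoscovici2024, §3.2 p. 10 (arXiv chunk p0008:L69); Prop. 4.2 (i) p. 18] -/
def gaussianVec : Lp ℂ 2 (volume : Measure ℝ) :=
  memLp_gaussianFun.toLp gaussianFun

/-- **`ξ_S := η_S(ξ_∞)`** (Prop. 4.2 (i)), pulled back: `ξ_p = η_p h₀ = Σ_k h₀(p^k ·)`.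
[cite: ConnesConsaniMoscovici2024, Prop. 4.2 (i) §4.2 p. 18 (arXiv chunk p0013:L3)] -/
def semilocalXi : Lp ℂ 2 (volume : Measure ℝ) :=
  semilocalEta p gaussianVec

/-- **Proposition 4.2 (i), the computation of its proof** (first display p. 18): "`𝒰_S(ξ_S)(s) =
𝒰_S(η_S(ξ_∞))(s) = (Π_{p∈S∖{∞}} L_p(½ − is))(𝔽_μ w_∞(ξ_∞))(s) = Π_{v∈S} L_v(½ − is)`", whence
"`𝒱_S(ξ_S)(s) = 1`" and `𝒱_S` "transforms … the vector `ξ_S` into the constant function".  Pulled back and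
with the constant made explicit: `mellin (primeSum p h₀) (½ − is) = 2^{−3/4}·L_p(½ − is)·L_∞(½ − is)`
(`𝔽_μ w_∞(h₀) = 2^{−3/4}L_∞(½ − is)` by Thm. 3.1 (i), `𝒰 = π^{−1/2}𝔽_μ∘w_∞`, `𝒰(h₀) = 2^{−3/4}π^{−1/2}L_∞`;
the printed "= Π_v L_v", "= 1" absorb this constant into the normalisation of `ξ_S`/`dm_S`).  The clause
"gives the canonical form of the cyclic pair `(ϑ_S, ξ_S)`" (unitarity of `𝒱_S`, `ϑ_S ↦` multiplication
by `s`) is Thm. 2.1 / Prop. 3.1 (§2–§3, seat t12) transported by `U` and is not restated here.  PROVED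
(theta-series form `u ↦ u²`, termwise Gamma integrals via Mathlib's `hasSum_mellin_pi_mul_sq`, geometric series
`Σ_k p^{−kz} = L_p(z)`).  RH-FREE.
[cite: ConnesConsaniMoscovici2024, Prop. 4.2 (i) §4.2 p. 18 (arXiv chunk p0013:L3–L17)] -/
theorem mellin_primeSum_gaussianFun (s : ℝ) :
    mellin (primeSum p gaussianFun) (1 / 2 - s * I) =
      (((2 : ℝ) ^ (-(3 / 4 : ℝ)) : ℝ) : ℂ) * eulerFactor p (1 / 2 - s * I) * Complex.Gammaℝ (1 / 2 - s * I) := by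
  have hp0 : (0 : ℝ) < p := by exact_mod_cast hp.out.pos
  have hp1 : (1 : ℝ) < p := by exact_mod_cast hp.out.one_lt
  set z : ℂ := 1 / 2 - s * I with hz
  have hzre : z.re = 1 / 2 := by simp [hz]
  have hz0 : 0 < z.re := by rw [hzre]; norm_num
  -- the theta-type function `F(t) = Σ_k 2^{1/4} e^{-π p^{2k} t}` with `primeSum p h₀ (u) = F(u²)`
  set c : ℂ := (((2 : ℝ) ^ (1 / 4 : ℝ) : ℝ) : ℂ) with hc
  set F : ℝ → ℂ := fun t => ∑' k : ℕ, c * (Real.exp (-π * ((p : ℝ) ^ k) ^ 2 * t) : ℂ) with hF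
  have hr0 : ∀ k : ℕ, (p : ℝ) ^ k ≠ 0 := fun k => pow_ne_zero k hp0.ne'
  have hr1 : ∀ k : ℕ, 1 ≤ (p : ℝ) ^ k := fun k => one_le_pow₀ hp1.le
  -- summability of the theta series for `t > 0`
  have hsum : ∀ t : ℝ, 0 < t → Summable fun k : ℕ => c * (Real.exp (-π * ((p : ℝ) ^ k) ^ 2 * t) : ℂ) := by
    intro t ht
    apply Summable.mul_left
    apply Summable.of_norm
    have hq : Real.exp (-π * t) < 1 := by
      have h := Real.exp_lt_exp.2 (show -π * t < 0 by nlinarith [Real.pi_pos])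
      rwa [Real.exp_zero] at h
    have hq0 : 0 ≤ Real.exp (-π * t) := (Real.exp_pos _).le
    refine Summable.of_nonneg_of_le (fun _ => norm_nonneg _) (fun k => ?_)
      ((summable_geometric_of_lt_one hq0 hq).mul_left (Real.exp (-π * t)))
    rw [Complex.norm_real, Real.norm_eq_abs, abs_of_pos (Real.exp_pos _), ← Real.exp_nat_mul,
      ← Real.exp_add, Real.exp_le_exp]
    have hk : (k : ℝ) + 1 ≤ ((p : ℝ) ^ k) ^ 2 := by
      have h2k : (k : ℝ) + 1 ≤ (2 : ℝ) ^ k := by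
        have := Nat.lt_two_pow_self (n := k)
        exact_mod_cast this
      calc (k : ℝ) + 1 ≤ (2 : ℝ) ^ k := h2k
        _ ≤ (p : ℝ) ^ k := by gcongr; exact_mod_cast hp.out.two_le
        _ ≤ ((p : ℝ) ^ k) ^ 2 := by nlinarith [hr1 k]
    have hk' : (π * t) * ((k : ℝ) + 1) ≤ (π * t) * ((p : ℝ) ^ k) ^ 2 :=
      mul_le_mul_of_nonneg_left hk (by positivity)
    nlinarith [hk']
  have hFsum : ∀ t ∈ Ioi (0 : ℝ),
      HasSum (fun k : ℕ => if (p : ℝ) ^ k = 0 then 0 else c * (Real.exp (-π * ((p : ℝ) ^ k) ^ 2 * t) : ℂ))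
        (F t) := by
    intro t ht
    simp only [hr0, if_false]
    exact (hsum t ht).hasSum
  have h_sum : Summable fun k : ℕ => ‖c‖ / |(p : ℝ) ^ k| ^ z.re := by
    rw [hzre]
    have : ∀ k : ℕ, ‖c‖ / |(p : ℝ) ^ k| ^ (1 / 2 : ℝ) = ‖c‖ * ((Real.sqrt p)⁻¹) ^ k := by
      intro k
      rw [abs_of_pos (pow_pos hp0 k), ← Real.rpow_natCast, ← Real.rpow_mul hp0.le, mul_comm (k : ℝ),
        Real.rpow_mul hp0.le, Real.rpow_natCast, ← Real.sqrt_eq_rpow, div_eq_mul_inv, ← inv_pow]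
    simp_rw [this]
    refine (summable_geometric_of_lt_one (by positivity) ?_).mul_left _
    exact inv_lt_one_of_one_lt₀ (by rw [show (1:ℝ) = Real.sqrt 1 by simp]; exact Real.sqrt_lt_sqrt zero_le_one hp1)
  have hmain := hasSum_mellin_pi_mul_sq (a := fun _ : ℕ => c) (r := fun k : ℕ => (p : ℝ) ^ k)
    hz0 hFsum h_sum
  -- identify the terms: `Γ_ℝ(z) c / |p^k|^z = Γ_ℝ(z) c (p^{-z})^k`
  have hterm : ∀ k : ℕ, Complex.Gammaℝ z * (fun _ : ℕ => c) k / ((|(fun k : ℕ => (p : ℝ) ^ k) k| : ℝ) : ℂ) ^ z =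
      Complex.Gammaℝ z * c * ((p : ℂ) ^ (-z)) ^ k := by
    intro k
    beta_reduce
    rw [abs_of_pos (pow_pos hp0 k), Complex.ofReal_pow, Complex.ofReal_natCast,
      ← Complex.cpow_nat_mul' (by rw [Complex.natCast_arg]; simp [Real.pi_pos])
        (by rw [Complex.natCast_arg]; simp [Real.pi_pos.le]),
      Complex.cpow_nat_mul, Complex.cpow_neg, div_eq_mul_inv, inv_pow]
  simp_rw [hterm] at hmain
  have hgeo : HasSum (fun k : ℕ => ((p : ℂ) ^ (-z)) ^ k) (1 - (p : ℂ) ^ (-z))⁻¹ :=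
    hasSum_geometric_of_norm_lt_one (norm_prime_cpow_neg_lt_one p s)
  have hF_mellin : mellin F (z / 2) = Complex.Gammaℝ z * c * (1 - (p : ℂ) ^ (-z))⁻¹ :=
    hmain.unique (hgeo.mul_left _)
  -- `primeSum p h₀ (u) = F(u²)` for `u > 0`, and `mellin (F ∘ (·)²) z = ½ mellin F (z/2)`
  have hcomp : ∀ u ∈ Ioi (0 : ℝ), primeSum p gaussianFun u = F (u ^ (2 : ℝ)) := by
    intro u _
    have hu2 : u ^ (2 : ℝ) = u ^ 2 := Real.rpow_two u
    simp only [primeSum, hF, gaussianFun, hc, hu2]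
    refine tsum_congr fun k => ?_
    have e : -(π * ((p : ℝ) ^ k * u) ^ 2) = -π * ((p : ℝ) ^ k) ^ 2 * u ^ 2 := by ring
    rw [Complex.ofReal_mul, e]
  have hmel : mellin (primeSum p gaussianFun) z = (1 / 2 : ℂ) * mellin F (z / 2) := by
    have h2 := mellin_comp_rpow F z 2
    rw [show |(2 : ℝ)|⁻¹ = 1 / 2 by norm_num] at h2
    rw [← Complex.coe_smul, show (((1 / 2 : ℝ)) : ℂ) = 1 / 2 by push_cast; ring, smul_eq_mul,
      show (z / (2 : ℝ) : ℂ) = z / 2 by push_cast; ring] at h2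
    rw [← h2]
    unfold mellin
    refine setIntegral_congr_fun measurableSet_Ioi fun u hu => ?_
    simp only [hcomp u hu]
  rw [hmel, hF_mellin, eulerFactor]
  simp only [hc]
  have h234 : (1 / 2 : ℂ) * (((2 : ℝ) ^ (1 / 4 : ℝ) : ℝ) : ℂ) = (((2 : ℝ) ^ (-(3 / 4 : ℝ)) : ℝ) : ℂ) := by
    rw [show (1 / 2 : ℂ) = (((2 : ℝ) ^ (-1 : ℝ) : ℝ) : ℂ) by
      rw [Real.rpow_neg_one]; push_cast; ring, ← Complex.ofReal_mul, ← Real.rpow_add two_pos]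
    norm_num
  rw [← h234]
  ring


/-! ### Proposition 4.2 (ii): the grading `𝔽_S` — `𝔽_S ξ_S = ξ_S` and `𝔽_S ϑ(λ) = ϑ(λ⁻¹) 𝔽_S` (PROVED)

"The cyclic pair `(ϑ_S, ξ_S)` is even and the grading is given by the Fourier transform `𝔽_S` which becomes
the symmetry `s ↦ −s` under the unitary transformation `𝒱_S`"; proof: "One checks directly that the Fourier
transform `𝔽_S` anticommutes with `ϑ_S`. It fixes the vector `ξ` by Prop. 4.1. The uniqueness of the grading
shows [the rest]."  Typed (pulled back to `L²(ℝ)`) as the two operator identities `𝔽_S ξ_S = ξ_S`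
(`semilocalFourier_semilocalXi`) and `𝔽_S ∘ D_a = |a|⁻¹D_{a⁻¹} ∘ 𝔽_S` for the dilations, i.e.
`𝔽_S ϑ(λ) = ϑ(λ⁻¹) 𝔽_S` for the scaling unitaries `ϑ(λ) = λ^{−1/2}D_{λ⁻¹}` of CC 2021 eq. (40)
(`semilocalFourier_lpDilation`); the clause "becomes `s ↦ −s` under `𝒱_S`" is Prop. 2.1's uniqueness of the
grading (§2, seat t12) and is not restated.
[cite: ConnesConsaniMoscovici2024, Prop. 4.2 (ii) §4.2 p. 18 (arXiv chunk p0013:L5, proof L17)] -/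

/-- Every dilation `D_a` commutes with `θ_p`. [cite: ConnesConsaniMoscovici2024, proof of Thm. 4.1 (ii) §4.3 p. 18 (arXiv chunk p0013:L52)] -/
theorem lpDilation_primeTwist_comm {a : ℝ} (ha : a ≠ 0) (u : Lp ℂ 2 (volume : Measure ℝ)) :
    lpDilation (V := ℝ) (F := ℂ) (p := (2 : ℝ≥0∞)) a ha ENNReal.ofNat_ne_top (primeTwist p u) =
      primeTwist p (lpDilation (V := ℝ) (F := ℂ) (p := (2 : ℝ≥0∞)) a ha ENNReal.ofNat_ne_top u) := by
  have hp0 : (0 : ℝ) < p := by exact_mod_cast hp.out.pos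
  have hpne : (p : ℝ) ≠ 0 := hp0.ne'
  have hθ : ∀ ζ : Lp ℂ 2 (volume : Measure ℝ), primeTwist p ζ = ζ - (p : ℂ)⁻¹ •
      lpDilation (V := ℝ) (F := ℂ) (p := (2 : ℝ≥0∞)) ((p : ℝ)⁻¹) (inv_ne_zero hpne)
        ENNReal.ofNat_ne_top ζ := fun ζ => by
    simp [primeTwist]
  rw [hθ, hθ, map_sub, map_smul]
  congr 2
  have h3 : lpDilation (V := ℝ) (F := ℂ) (p := (2 : ℝ≥0∞)) a ha ENNReal.ofNat_ne_top *
      lpDilation (V := ℝ) (F := ℂ) (p := (2 : ℝ≥0∞)) ((p : ℝ)⁻¹) (inv_ne_zero hpne) ENNReal.ofNat_ne_top =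
      lpDilation (V := ℝ) (F := ℂ) (p := (2 : ℝ≥0∞)) ((p : ℝ)⁻¹) (inv_ne_zero hpne)
        ENNReal.ofNat_ne_top * lpDilation (V := ℝ) (F := ℂ) (p := (2 : ℝ≥0∞)) a ha ENNReal.ofNat_ne_top := by
    rw [lpDilation_mul, lpDilation_mul]
    exact lpDilation_congr (mul_comm _ _) _ _
  exact congrArg (fun T => T u) h3

/-- Every dilation `D_a` commutes with `θ_p⁻¹`. [cite: ConnesConsaniMoscovici2024, proof of Thm. 4.6 §4.7 p. 23 (arXiv chunk p0015:L88)] -/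
theorem lpDilation_primeTwistEquiv_symm_comm {a : ℝ} (ha : a ≠ 0) (u : Lp ℂ 2 (volume : Measure ℝ)) :
    lpDilation (V := ℝ) (F := ℂ) (p := (2 : ℝ≥0∞)) a ha ENNReal.ofNat_ne_top ((primeTwistEquiv p).symm u) =
      (primeTwistEquiv p).symm (lpDilation (V := ℝ) (F := ℂ) (p := (2 : ℝ≥0∞)) a ha ENNReal.ofNat_ne_top u) := by
  apply (primeTwistEquiv p).injective
  rw [ContinuousLinearEquiv.apply_symm_apply, primeTwistEquiv_apply, ← lpDilation_primeTwist_comm,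
    ← primeTwistEquiv_apply, ContinuousLinearEquiv.apply_symm_apply]

/-- **Proposition 4.2 (ii), PROVED (second clause)**: "the Fourier transform `𝔽_S` anticommutes with `ϑ_S`"
— at the level of the scaling group: the pulled-back `𝔽_S` obeys the dilation law `𝔽_S ∘ D_a = |a|⁻¹D_{a⁻¹} ∘
𝔽_S`, i.e. `𝔽_S ϑ(λ) = ϑ(λ⁻¹) 𝔽_S` for `ϑ(λ) = λ^{−1/2}D_{λ⁻¹}` (CC 2021 eq. (40)), whose generator form is
`𝔽_S ϑ_S = −ϑ_S 𝔽_S`.  RH-FREE. [cite: ConnesConsaniMoscovici2024, proof of Prop. 4.2 (ii) §4.2 p. 18 (arXiv chunk p0013:L17)] -/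
theorem semilocalFourier_lpDilation {a : ℝ} (ha : a ≠ 0) (ξ : Lp ℂ 2 (volume : Measure ℝ)) :
    semilocalFourier p (lpDilation (V := ℝ) (F := ℂ) (p := (2 : ℝ≥0∞)) a ha ENNReal.ofNat_ne_top ξ) =
      ((|a|⁻¹ : ℝ) : ℂ) • lpDilation (V := ℝ) (F := ℂ) (p := (2 : ℝ≥0∞)) a⁻¹ (inv_ne_zero ha)
        ENNReal.ofNat_ne_top (semilocalFourier p ξ) := by
  rw [semilocalFourier_apply, semilocalFourier_apply, ← lpDilation_primeTwistEquiv_symm_comm,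
    fourier_lpDilation ha, RCLike.real_smul_eq_coe_smul (K := ℂ), map_smul, lpDilation_primeTwist_comm]
  rfl

omit hp in
/-- `h₀` is integrable. [cite: ConnesConsaniMoscovici2024, §3.2 p. 10 (arXiv chunk p0008:L69)] -/
theorem integrable_gaussianFun : Integrable gaussianFun := by
  have h : Integrable (fun x : ℝ => (2 : ℝ) ^ (1 / 4 : ℝ) * Real.exp (-π * x ^ 2)) :=
    (integrable_exp_neg_mul_sq Real.pi_pos).const_mul _
  simp_rw [neg_mul] at h
  exact h.ofReal

omit hp in
/-- **`𝓕 h₀ = h₀`** at function level ("The vector `ξ_∞ = h₀` is invariant under `𝓕_{e_ℝ}`", proof of Prop. 3.1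
(ii); Mathlib's `fourier_gaussian_pi`). [cite: ConnesConsaniMoscovici2024, proof of Prop. 3.1 (ii) §3.2 p. 10 (arXiv chunk p0008:L101)] -/
theorem fourierIntegral_gaussianFun : 𝓕 gaussianFun = gaussianFun := by
  set c : ℂ := (((2 : ℝ) ^ (1 / 4 : ℝ) : ℝ) : ℂ) with hc
  set g : ℝ → ℂ := fun y => cexp (-π * (1 : ℂ) * (y : ℂ) ^ 2) with hg
  have hfun : gaussianFun = c • g := by
    funext x
    simp only [gaussianFun, Pi.smul_apply, smul_eq_mul, hg, hc]
    push_cast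
    ring_nf
  have hF : 𝓕 g = g := by
    rw [hg, fourier_gaussian_pi (by simp : 0 < (1 : ℂ).re)]
    funext t
    simp
  have hsmul : 𝓕 (c • g) = c • 𝓕 g := VectorFourier.fourierIntegral_const_smul _ _ _ g c
  rw [hfun, hsmul, hF]

omit hp in
/-- **`𝓕 ξ_∞ = ξ_∞` in `L²(ℝ)`** (the `L²` Fourier transform agrees with the Fourier integral on `L¹ ∩ L²`).
[cite: ConnesConsaniMoscovici2024, proof of Prop. 3.1 (ii) §3.2 p. 10 (arXiv chunk p0008:L101)] -/
theorem fourier_gaussianVec : (𝓕 gaussianVec : Lp ℂ 2 (volume : Measure ℝ)) = gaussianVec := by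
  apply Lp.ext
  have h := Literature.Analysis.FunctionSpaces.fourier_toLp_ae_eq_fourierIntegral
    integrable_gaussianFun memLp_gaussianFun
  rw [fourierIntegral_gaussianFun] at h
  exact h.trans (memLp_gaussianFun.coeFn_toLp).symm

/-- **Proposition 4.2 (ii), PROVED (first clause)**: "the grading is given by the Fourier transform `𝔽_S` …
It fixes the vector `ξ` by Prop. 4.1" — `semilocalFourier p ξ_p = ξ_p`, from Prop. 4.1 (iii)
(`semilocalFourier_semilocalEta`) and `𝓕h₀ = h₀`.  RH-FREE.
[cite: ConnesConsaniMoscovici2024, Prop. 4.2 (ii) §4.2 p. 18 (arXiv chunk p0013:L5, proof L17)] -/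
theorem semilocalFourier_semilocalXi : semilocalFourier p (semilocalXi p) = semilocalXi p := by
  unfold semilocalXi
  rw [semilocalFourier_semilocalEta, fourier_gaussianVec]


omit hp in
/-- `|1 − p^{−1/2−is}|` lies between `1 − p^{−1/2}` and `1 + p^{−1/2}` — "the function `Π_p L_p(½ − is)` is
bounded with bounded inverse" (proof of Prop. 4.3 (i)).  Lower bound. [cite: ConnesConsaniMoscovici2024, proof of Prop. 4.3 (i) §4.2 p. 18 (arXiv chunk p0013:L36)] -/
theorem one_sub_inv_sqrt_le_norm {q : ℕ} (hq : 1 < q) (s : ℝ) :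
    1 - (Real.sqrt q)⁻¹ ≤ ‖1 - (q : ℂ) ^ (-(1 / 2 - s * I))‖ := by
  have hq0 : (0 : ℝ) < q := by exact_mod_cast (zero_lt_one.trans hq)
  have hnorm : ‖(q : ℂ) ^ (-(1 / 2 - s * I))‖ = (Real.sqrt q)⁻¹ := by
    rw [Complex.norm_natCast_cpow_of_pos (zero_lt_one.trans hq)]
    simp only [neg_sub, sub_re, mul_re, ofReal_re, I_re, mul_zero, ofReal_im, I_im, mul_one,
      sub_self, one_div]
    rw [show (0 : ℝ) - (2 : ℂ)⁻¹.re = -(1 / 2) by norm_num, Real.rpow_neg hq0.le, Real.sqrt_eq_rpow,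
      one_div]
  calc 1 - (Real.sqrt q)⁻¹ = ‖(1 : ℂ)‖ - ‖(q : ℂ) ^ (-(1 / 2 - s * I))‖ := by rw [hnorm, norm_one]
    _ ≤ ‖1 - (q : ℂ) ^ (-(1 / 2 - s * I))‖ := norm_sub_norm_le _ _

omit hp in
/-- Upper bound `|1 − p^{−1/2−is}| ≤ 1 + p^{−1/2}`. [cite: ConnesConsaniMoscovici2024, proof of Prop. 4.3 (i) §4.2 p. 18 (arXiv chunk p0013:L36)] -/
theorem norm_one_sub_le_one_add_inv_sqrt {q : ℕ} (hq : 1 < q) (s : ℝ) :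
    ‖1 - (q : ℂ) ^ (-(1 / 2 - s * I))‖ ≤ 1 + (Real.sqrt q)⁻¹ := by
  have hq0 : (0 : ℝ) < q := by exact_mod_cast (zero_lt_one.trans hq)
  have hnorm : ‖(q : ℂ) ^ (-(1 / 2 - s * I))‖ = (Real.sqrt q)⁻¹ := by
    rw [Complex.norm_natCast_cpow_of_pos (zero_lt_one.trans hq)]
    simp only [neg_sub, sub_re, mul_re, ofReal_re, I_re, mul_zero, ofReal_im, I_im, mul_one,
      sub_self, one_div]
    rw [show (0 : ℝ) - (2 : ℂ)⁻¹.re = -(1 / 2) by norm_num, Real.rpow_neg hq0.le, Real.sqrt_eq_rpow,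
      one_div]
  calc ‖1 - (q : ℂ) ^ (-(1 / 2 - s * I))‖ ≤ ‖(1 : ℂ)‖ + ‖(q : ℂ) ^ (-(1 / 2 - s * I))‖ := norm_sub_le _ _
    _ = 1 + (Real.sqrt q)⁻¹ := by rw [hnorm, norm_one]

/-- **Proposition 4.3 (i)**: "The map `ι_S` is bounded with bounded inverse", `ι_S : L²(ℝ, dm) → L²(ℝ, dm_S)`
the identity map; proof: "the function `Π_{p∈S∖{∞}} L_p(½ − is)` is bounded with bounded inverse, so that the
Radon–Nikodym derivatives `dm/dm_S` and `dm_S/dm` are both bounded."  Typed as exactly that two-sided bound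
for `S = {∞, p}`: `(1 + p^{−1/2})⁻¹ ≤ |L_p(½ − is)| ≤ (1 − p^{−1/2})⁻¹` for all real `s`
(`dm_S/dm = |L_p(½ − is)|²`).  PROVED.  RH-FREE.
[cite: ConnesConsaniMoscovici2024, Prop. 4.3 (i) §4.2 p. 18 (arXiv chunk p0013:L21, proof L36)] -/
theorem norm_eulerFactor_bounds (s : ℝ) :
    (1 + (Real.sqrt p)⁻¹)⁻¹ ≤ ‖eulerFactor p (1 / 2 - s * I)‖ ∧
      ‖eulerFactor p (1 / 2 - s * I)‖ ≤ (1 - (Real.sqrt p)⁻¹)⁻¹ := by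
  have hp1 : 1 < p := hp.out.one_lt
  have hsqrt : 1 < Real.sqrt p := by
    rw [show (1 : ℝ) = Real.sqrt 1 by simp]
    exact Real.sqrt_lt_sqrt zero_le_one (by exact_mod_cast hp1)
  have hlow : 0 < 1 - (Real.sqrt p)⁻¹ := by
    rw [sub_pos]; exact inv_lt_one_of_one_lt₀ hsqrt
  have h1 := one_sub_inv_sqrt_le_norm hp1 s
  have h2 := norm_one_sub_le_one_add_inv_sqrt hp1 s
  have hpos : 0 < ‖1 - (p : ℂ) ^ (-(1 / 2 - s * I))‖ := lt_of_lt_of_le hlow h1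
  unfold eulerFactor
  rw [norm_inv]
  exact ⟨by rw [inv_le_inv₀ (by positivity) hpos]; exact h2,
    by rw [inv_le_inv₀ hpos hlow]; exact h1⟩

/-- `L_p(½ − is) ≠ 0`. [cite: ConnesConsaniMoscovici2024, proof of Prop. 4.3 (i) §4.2 p. 18 (arXiv chunk p0013:L36)] -/
theorem eulerFactor_ne_zero (s : ℝ) : eulerFactor p (1 / 2 - s * I) ≠ 0 := by
  intro h
  have h1 := (norm_eulerFactor_bounds p s).1
  rw [h, norm_zero] at h1
  have : (0 : ℝ) < (1 + (Real.sqrt p)⁻¹)⁻¹ := by positivity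
  linarith

/-- **Proposition 4.3 (ii)** (diagram (49): `𝒱_S ∘ η_S = ι_S ∘ 𝒱`), pulled back and at function level:
`ℳ_S(𝒰(η_p f)) = ℳ(𝒰 f)`, i.e. `(L_∞L_p)⁻¹ · mellin (primeSum p f) = L_∞⁻¹ · mellin f` on the critical line —
"(ii) This follows from (47)": PROVED from the named fact Prop. 4.1 (i).  RH-FREE.
[cite: ConnesConsaniMoscovici2024, Prop. 4.3 (ii) diagram (49) §4.2 p. 18 (arXiv chunk p0013:L23–L36)] -/
theorem semilocalV_primeSum_of_prop_4_1_i (hi : ConnesConsaniMoscovici2024_prop_4_1_i p)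
    {f : ℝ → ℂ} {s : ℝ} (hf : MellinConvergent f (1 / 2 - s * I)) :
    semilocalV p (primeSum p f) s = (Complex.Gammaℝ (1 / 2 - s * I))⁻¹ * mellin f (1 / 2 - s * I) := by
  unfold semilocalV semilocalM semilocalMultiplier
  beta_reduce
  rw [hi f s hf, mul_inv, mul_assoc, ← mul_assoc (eulerFactor p (1 / 2 - s * I))⁻¹,
    inv_mul_cancel₀ (eulerFactor_ne_zero p s), one_mul]

/-- **Proposition 4.3 (ii)** unconditionally (diagram (49) pulled back, at function level): `𝒱_S(η_p f) = ℳ(𝒰f)`,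
i.e. `(L_∞L_p)⁻¹ · mellin (Σ_k f(p^k ·)) (½ − is) = L_∞⁻¹ · mellin f (½ − is)`.  PROVED (Prop. 4.1 (i) discharged).
RH-FREE. [cite: ConnesConsaniMoscovici2024, Prop. 4.3 (ii) diagram (49) §4.2 p. 18 (arXiv chunk p0013:L23–L36)] -/
theorem semilocalV_primeSum {f : ℝ → ℂ} {s : ℝ} (hf : MellinConvergent f (1 / 2 - s * I)) :
    semilocalV p (primeSum p f) s = (Complex.Gammaℝ (1 / 2 - s * I))⁻¹ * mellin f (1 / 2 - s * I) :=
  semilocalV_primeSum_of_prop_4_1_i p (ConnesConsaniMoscovici2024_prop_4_1_i_holds p) hf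

end Transform

/-! ## §4.3 The semilocal Hermite operator (pp. 18–19): the filtration `E_n^S`, Theorem 4.1, Remark 4.2 -/

section Hermite

/-- The even Gaussian monomials `x^{2k}e^{−πx²}` — the functions `P(x)e^{−πx²}`, `P` even, of §3.3 and of the
proof of Thm. 4.1 (ii) ("`E_n^S` is the image by `η_S` of the space of products `P(x)e^{−πx²}` where `P` is an
even polynomial of degree `≤ 2n`"). [cite: ConnesConsaniMoscovici2024, proof of Thm. 4.1 (ii) §4.3 p. 18 (arXiv chunk p0013:L52); §3.3 p. 11 (chunk p0008:L121)] -/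
def gaussMonomialFun (k : ℕ) (x : ℝ) : ℂ :=
  ((x ^ (2 * k) * Real.exp (-(π * x ^ 2)) : ℝ) : ℂ)

/-- Continuity of `x^{2k}e^{−πx²}`. [cite: ConnesConsaniMoscovici2024, §3.3 p. 11 (arXiv chunk p0008:L121)] -/
theorem continuous_gaussMonomialFun (k : ℕ) : Continuous (gaussMonomialFun k) := by
  unfold gaussMonomialFun
  fun_prop

/-- `x^{2k}e^{−πx²} ∈ L²(ℝ)` (`x^{4k}e^{−2πx²}` is integrable). [cite: ConnesConsaniMoscovici2024, §3.3 p. 11 (arXiv chunk p0008:L121)] -/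
theorem memLp_gaussMonomialFun (k : ℕ) : MemLp (gaussMonomialFun k) 2 (volume : Measure ℝ) := by
  rw [memLp_two_iff_integrable_sq_norm (continuous_gaussMonomialFun k).aestronglyMeasurable]
  have hk : (-1 : ℝ) < ((4 * k : ℕ) : ℝ) := by
    have : (0 : ℝ) ≤ ((4 * k : ℕ) : ℝ) := by positivity
    linarith
  have hint : Integrable (fun x : ℝ => x ^ ((4 * k : ℕ) : ℝ) * Real.exp (-(2 * π) * x ^ 2)) :=
    integrable_rpow_mul_exp_neg_mul_sq (by positivity) hk
  refine hint.congr (Eventually.of_forall fun x => ?_)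
  simp only [gaussMonomialFun, Complex.norm_real, Real.norm_eq_abs, Real.rpow_natCast, sq_abs]
  have h1 : (x ^ (2 * k)) ^ 2 = x ^ (4 * k) := by rw [← pow_mul]; congr 1; ring
  have h2 : Real.exp (-(π * x ^ 2)) ^ 2 = Real.exp (-(2 * π) * x ^ 2) := by
    rw [← Real.exp_nat_mul]; congr 1; push_cast; ring
  rw [mul_pow, h1, h2]

/-- The vectors `x^{2k}e^{−πx²} ∈ L²(ℝ)`. [cite: ConnesConsaniMoscovici2024, §3.3 p. 11 (arXiv chunk p0008:L121)] -/
def gaussMonomialVec (k : ℕ) : Lp ℂ 2 (volume : Measure ℝ) :=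
  (memLp_gaussMonomialFun k).toLp (gaussMonomialFun k)

/-- A finite combination `Σ_{k ≤ n} c_k x^{2k}e^{−πx²}` — an "`P(x)e^{−πx²}`, `P` even of degree `≤ 2n`" — as a
vector of `L²(ℝ)`. [cite: ConnesConsaniMoscovici2024, proof of Thm. 4.1 (ii) §4.3 p. 18 (arXiv chunk p0013:L52)] -/
def gaussComb (n : ℕ) (c : ℕ → ℂ) : Lp ℂ 2 (volume : Measure ℝ) :=
  ∑ k ∈ Finset.range (n + 1), c k • gaussMonomialVec k

/-- **`E_n` for `S = {∞}`** (§3.3): "the subspace `E_n ⊂ L²(ℝ)^{ev}`, linear span of the vectors `ϑ^jξ_∞` for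
`j ≤ n`, is formed of the even functions `e^{−πx²}P(x)` where `P(x)` is an even polynomial of degree `≤ 2n`" —
typed by that description: the span of `x^{2k}e^{−πx²}`, `k ≤ n` (the identification with `span{ϑ^jξ_∞}`
is the quoted sentence; `ϑ = −i(x∂_x + ½)` raises the degree by `2`, `scalingGenCoeff`).
[cite: ConnesConsaniMoscovici2024, §3.3 p. 11 (arXiv chunk p0008:L121); §2 p. 6 (chunk p0006:L3)] -/
def archFiltration (n : ℕ) : Submodule ℂ (Lp ℂ 2 (volume : Measure ℝ)) :=
  Submodule.span ℂ (gaussMonomialVec '' Set.Iic n)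

variable (p : ℕ) [hp : Fact p.Prime]

/-- **`E_n^S`**, `S = {∞, p}`, pulled back: "`E_n^S` is the image by `η_S` of the space of products
`P(x)e^{−πx²}` where `P` is an even polynomial of degree `≤ 2n`" (proof of Thm. 4.1 (ii); by definition the
span of `ϑ_S^jξ_S`, `j ≤ n`, §4.3 first paragraph — "the scaling operator commutes with `η_S`").
[cite: ConnesConsaniMoscovici2024, §4.3 p. 18 (arXiv chunk p0013:L41); proof of Thm. 4.1 (ii) (chunk p0013:L52)] -/
def semilocalFiltration (n : ℕ) : Submodule ℂ (Lp ℂ 2 (volume : Measure ℝ)) :=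
  (archFiltration n).map (semilocalEta p).toLinearMap

/-- **The eigenspaces of the semilocal Hermite operator `N_S`**: "`N_S` is defined as the grading operator
associated with the filtration `(E_n)` of the Hilbert space `L²(X_S)^{K_S}`" (§4.3), i.e. `N_S = n` on
`E_n^S ⊖ E_{n−1}^S`; pulled back, layer `n` is `E_n^S ∩ (E_{n−1}^S)^⊥` (`E_{−1}^S = 0`).  `N_S` itself
(unbounded, diagonal in the Gram–Schmidt basis) is determined by these layers and is not given a separate symbol.
[cite: ConnesConsaniMoscovici2024, §4.3 p. 18 (arXiv chunk p0013:L41); §2 p. 6 (chunk p0006:L14)] -/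
def semilocalLayer (n : ℕ) : Submodule ℂ (Lp ℂ 2 (volume : Measure ℝ)) :=
  semilocalFiltration p n ⊓ (⨆ (k : ℕ) (_ : k < n), semilocalFiltration p k)ᗮ

omit hp in
/-- **The scaling generator on Gaussian polynomials.**  `ϑ = −i(H + ½)`, `H = x∂_x` (§3.2), acts on
`x^{2k}e^{−πx²}` by `(H + ½)(x^{2k}e^{−πx²}) = (2k + ½)x^{2k}e^{−πx²} − 2πx^{2k+2}e^{−πx²}` (§3.4:
"`H(e^{−πx²}x^k) = e^{−πx²}x^k(−2πx² + k)`"); on coefficient sequences of `Σ_k c_k x^{2k}e^{−πx²}`: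
`(ϑc)_k = −i((2k + ½)c_k − 2πc_{k−1})`.  Since "the scaling operator commutes with `η_S`" (proof of Thm. 4.1
(ii)), `ϑ_S(η_p Σ c_k x^{2k}e^{−πx²}) = η_p(Σ (ϑc)_k x^{2k}e^{−πx²})`.
[cite: ConnesConsaniMoscovici2024, §3.2 p. 10 (arXiv chunk p0008:L63); §3.4 p. 12 (chunk p0009:L44–L48); proof of Thm. 4.1 (ii) p. 18] -/
def scalingGenCoeff (c : ℕ → ℂ) (k : ℕ) : ℂ :=
  -I * ((2 * k + 1 / 2 : ℂ) * c k - 2 * π * (if k = 0 then 0 else c (k - 1)))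

/-- **Theorem 4.1 (ii)**, pulled back: "The eigenfunctions of the semilocal Hermite operator `N_S` are elements
of `L²(X_S)^{K_S}` of the form `η_S(P_n^S(x)e^{−πx²})`, where `P_n^S` are polynomials obtained by
orthonormalization and induction" — every layer `E_n^S ⊖ E_{n−1}^S` is the line spanned by
`η_p(Σ_{k≤n} c_k x^{2k}e^{−πx²})` for some coefficients with `c_n ≠ 0`.  (Thm. 4.1 (i), "for `S = {∞}` `N_S` is
the restriction of the harmonic oscillator to `L²(ℝ)^{ev}`", IS Prop. 3.2 of §3.3 — seat t12's file — and is not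
restated.)  Named fact, DISCHARGED below (`ConnesConsaniMoscovici2024_thm_4_1_ii_holds`, Gram–Schmidt in `E_n^S`).
RH-FREE. [cite: ConnesConsaniMoscovici2024, Thm. 4.1 (ii) §4.3 p. 18 (arXiv chunk p0013:L47, proof L52)] -/
def ConnesConsaniMoscovici2024_thm_4_1_ii (p : ℕ) [Fact p.Prime] : Prop :=
  ∀ n : ℕ, ∃ c : ℕ → ℂ, c n ≠ 0 ∧
    semilocalLayer p n = ℂ ∙ semilocalEta p (gaussComb n c)

/-- **Theorem 4.1 (iii)**, pulled back: "The matrix of `ϑ_S` in the above orthonormal basis of `L²(X_S)^{K_S}` is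
a Jacobi hermitian matrix" (proof: "Follows from (6) [`Dξ_n = a_{n−1}ξ_{n−1} + a_nξ_{n+1}`], the general
theory of orthogonal polynomials").  Typed on the layers: for a layer-`m` vector `η_p(Σ_{k≤m} c_k x^{2k}e^{−πx²})`,
(coefficients `c` supported in `k ≤ m`), its image under `ϑ_S`, namely `η_p(Σ_{k≤m+1} (ϑc)_k x^{2k}e^{−πx²})`
(`scalingGenCoeff`), is orthogonal to every layer `n` with `n ≠ m ± 1` (tridiagonal with zero diagonal — eq. (6),
the even case of §2.2; the pair `(ϑ_S, ξ_S)` is even by Prop. 4.2 (ii)).  Hermitian symmetry of the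
two off-diagonals is then `ϑ_S = ϑ_S^*`.  Named fact, DISCHARGED below
(`ConnesConsaniMoscovici2024_thm_4_1_iii_holds`, section `JacobiDischarge`).  RH-FREE.
[cite: ConnesConsaniMoscovici2024, Thm. 4.1 (iii) §4.3 p. 18 (arXiv chunk p0013:L49, proof L52); §2 eq. (6) p. 6] -/
def ConnesConsaniMoscovici2024_thm_4_1_iii (p : ℕ) [Fact p.Prime] : Prop :=
  ∀ (m n : ℕ) (c : ℕ → ℂ), (∀ k, m < k → c k = 0) →
    semilocalEta p (gaussComb m c) ∈ semilocalLayer p m →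
    n + 1 ≠ m → m + 1 ≠ n →
      ∀ v ∈ semilocalLayer p n,
        ⟪semilocalEta p (gaussComb (m + 1) (scalingGenCoeff c)), v⟫_ℂ = 0

/-- **Remark 4.2 (iii)** (eq. (50)): "unless `S = {∞}` one has `|·|_S² η_S(f) ≠ η_S(|·|²f)`" — proof: under
`w_S` the left side is `u²ℰ_p(f)(u)` while the right side "evaluated at `u` gives the different expression
`u^{1/2}Σ_ℕ u²p^{2n}f(p^nu)`".  PROVED at function level with an explicit witness (`f = 1_{[1,p]}`, `u = 1`:
`Σ_n p^{2n}f(p^n) = 1 + p² ≠ 2 = Σ_n f(p^n)`).  (Rem. 4.2 (i): "`N_S ∘ η_S ≠ η_S ∘ N_∞` unless `S = {∞}`, but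
the filtrations … correspond to each other by the map `η_S`" — the correspondence is the definition of
`semilocalFiltration`; (ii) "another guess for the semilocal analogue of the Hermite operator" is a programme
sentence — neither is typed as a statement.)  RH-FREE.
[cite: ConnesConsaniMoscovici2024, Rem. 4.2 (iii) eq. (50) §4.3 p. 19 (arXiv chunk p0013:L68–L84)] -/
theorem exists_primeSum_sq_mul_ne :
    ∃ f : ℝ → ℂ, primeSum p (fun x => ((x ^ 2 : ℝ) : ℂ) * f x) 1 ≠
      (((1 : ℝ) ^ 2 : ℝ) : ℂ) * primeSum p f 1 := by
  have hp2 : 2 ≤ p := hp.out.two_le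
  have hp2' : (2 : ℝ) ≤ p := by exact_mod_cast hp2
  refine ⟨Set.indicator (Icc (1 : ℝ) p) 1, ?_⟩
  -- the values `f(p^k)`: `1` for `k ≤ 1`, `0` for `k ≥ 2`
  have hval : ∀ k : ℕ, Set.indicator (Icc (1 : ℝ) p) (1 : ℝ → ℂ) ((p : ℝ) ^ k * 1) =
      if k < 2 then 1 else 0 := by
    intro k
    rw [mul_one]
    by_cases hk : k < 2
    · rw [if_pos hk, Set.indicator_of_mem, Pi.one_apply]
      refine ⟨one_le_pow₀ (by linarith), ?_⟩
      interval_cases k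
      · rw [pow_zero]; linarith
      · rw [pow_one]
    · rw [if_neg hk, Set.indicator_of_notMem]
      simp only [Set.mem_Icc, not_and, not_le]
      intro _
      calc (p : ℝ) = (p : ℝ) ^ 1 := (pow_one _).symm
        _ < (p : ℝ) ^ k := pow_lt_pow_right₀ (by linarith) (by omega)
  have hsum1 : primeSum p (Set.indicator (Icc (1 : ℝ) p) 1) 1 = 2 := by
    rw [primeSum, tsum_eq_sum (s := Finset.range 2)]
    · simp only [hval, Finset.sum_range_succ, Finset.sum_range_zero]
      norm_num
    · intro k hk
      rw [hval, if_neg (by simpa using hk)]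
  have hsum2 : primeSum p (fun x => ((x ^ 2 : ℝ) : ℂ) * Set.indicator (Icc (1 : ℝ) p) 1 x) 1 =
      1 + (p : ℂ) ^ 2 := by
    rw [primeSum, tsum_eq_sum (s := Finset.range 2)]
    · simp only [hval, Finset.sum_range_succ, Finset.sum_range_zero]
      push_cast
      ring
    · intro k hk
      simp only [hval, if_neg (show ¬ k < 2 by simpa using hk), mul_zero]
  rw [hsum1, hsum2]
  push_cast
  intro h
  have h' : (p : ℂ) ^ 2 = 1 := by linear_combination h
  have h'' : ((p ^ 2 : ℕ) : ℂ) = ((1 : ℕ) : ℂ) := by push_cast; exact h'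
  have := Nat.cast_injective h''
  nlinarith

end Hermite

/-! ## §4.4 The dual transform (pp. 19–20): `E_S`, `β_S`, Definition 4.3, Proposition 4.4 -/

section Dual

variable (p : ℕ) [hp : Fact p.Prime]

/-- **`E_S(s) := Π_{v∈S} L_v(½ + is)`** (eq. (51); the product includes the archimedean factor
`E_∞(s) = L_∞(½ + is)`, cf. Prop. 4.7 (ii)), `S = {∞, p}`.
[cite: ConnesConsaniMoscovici2024, §4.4 eq. (51) p. 19 (arXiv chunk p0013:L89)] -/
def dualMultiplier (s : ℝ) : ℂ :=
  Complex.Gammaℝ (1 / 2 + s * I) * eulerFactor p (1 / 2 + s * I)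

omit hp in
/-- `E_∞(s) = L_∞(½ + is)` (the case `S = {∞}` of eq. (51)). [cite: ConnesConsaniMoscovici2024, §4.4 eq. (51) p. 19; Prop. 4.7 (ii) p. 22 (arXiv chunk p0015:L44)] -/
def archDualMultiplier (s : ℝ) : ℂ :=
  Complex.Gammaℝ (1 / 2 + s * I)

/-- **`β_S`** (eq. (52)): `β_S(F)(s) := (Π_{v∈S} L_v(½ + is)) F(s)` (the unitary `L²(ℝ) → L²(ℝ, ds/|E_S(s)|²)`).
[cite: ConnesConsaniMoscovici2024, §4.4 eq. (52) p. 20 (arXiv chunk p0013:L93)] -/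
def betaMul (F : ℝ → ℂ) (s : ℝ) : ℂ :=
  dualMultiplier p s * F s

/-- **The measure `ds/|E_S(s)|²`** of the Hilbert space `L²(ℝ, ds/|E_S(s)|²)` (§4.4). [cite: ConnesConsaniMoscovici2024, §4.4 p. 20 (arXiv chunk p0013:L91)] -/
def dualMeasure : Measure ℝ :=
  volume.withDensity fun s => ENNReal.ofReal ((‖dualMultiplier p s‖ ^ 2)⁻¹)

/-- **Definition 4.3 — the dual (Hardy–Titchmarsh) transform `υ_S := β_S ∘ 𝒰_S`** (eq. (53)),
`υ_S : L²(X_S)^{K_S} → L²(ℝ, ds/|E_S(s)|²)`; pulled back to `L²(ℝ)^{ev}` and at function level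
(`𝒰_S ∘ U = 𝔽_μ ∘ w_∞ = mellin · (½ − is)`): `υ_S(f)(s) = E_S(s) · mellin f (½ − is)`.
[cite: ConnesConsaniMoscovici2024, Def. 4.3 eq. (53) §4.4 p. 20 (arXiv chunk p0013:L97–L101)] -/
def dualTransform (f : ℝ → ℂ) (s : ℝ) : ℂ :=
  betaMul p (fun s' => mellin f (1 / 2 - s' * I)) s

omit hp in
/-- `υ_∞(f)(s) = L_∞(½ + is) · mellin f (½ − is)` — the case `S = {∞}` of Def. 4.3, target of the diagram (59).
[cite: ConnesConsaniMoscovici2024, Def. 4.3 §4.4 p. 20; Prop. 4.7 (ii) diagram (59) p. 22 (arXiv chunk p0015:L44–L56)] -/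
def archDualTransform (f : ℝ → ℂ) (s : ℝ) : ℂ :=
  archDualMultiplier s * mellin f (1 / 2 - s * I)

omit hp in
/-- `conj (q^{−z}) = q^{−conj z}` for a natural base. [folklore] -/
private theorem conj_natCast_cpow_neg (q : ℕ) (z : ℂ) :
    conj ((q : ℂ) ^ (-z)) = (q : ℂ) ^ (-conj z) := by
  have harg : ((q : ℂ)).arg ≠ π := by rw [Complex.natCast_arg]; exact Real.pi_ne_zero.symm
  rw [← map_neg, Complex.cpow_conj _ _ harg, Complex.conj_natCast]

omit hp in
/-- "the equality valid for any place `v` and `s ∈ ℝ`, `conj L_v(½ + is) = L_v(½ − is)`" — finite place.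
[cite: ConnesConsaniMoscovici2024, proof of Prop. 4.4 §4.4 p. 20 (arXiv chunk p0014:L3–L7)] -/
theorem conj_eulerFactor (q : ℕ) (s : ℝ) :
    conj (eulerFactor q (1 / 2 + s * I)) = eulerFactor q (1 / 2 - s * I) := by
  unfold eulerFactor
  rw [map_inv₀, map_sub, map_one, conj_natCast_cpow_neg]
  congr 3
  simp only [map_add, map_mul, Complex.conj_I, map_div₀, map_one, Complex.conj_ofReal, map_ofNat]
  ring

omit hp in
/-- `conj L_∞(½ + is) = L_∞(½ − is)` — archimedean place (`L_∞ = Γ_ℝ`, `Γ(conj z) = conj Γ(z)`).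
[cite: ConnesConsaniMoscovici2024, proof of Prop. 4.4 §4.4 p. 20 (arXiv chunk p0014:L3–L7)] -/
theorem conj_Gammaℝ_half_add (s : ℝ) :
    conj (Complex.Gammaℝ (1 / 2 + s * I)) = Complex.Gammaℝ (1 / 2 - s * I) := by
  have hconj : conj (1 / 2 + (s : ℂ) * I) = 1 / 2 - s * I := by
    simp only [map_add, map_mul, Complex.conj_I, map_div₀, map_one, Complex.conj_ofReal, map_ofNat]
    ring
  have hπarg : ((π : ℝ) : ℂ).arg ≠ π := by
    rw [Complex.arg_ofReal_of_nonneg Real.pi_pos.le]; exact Real.pi_ne_zero.symm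
  have hcpow : ∀ w : ℂ, conj ((π : ℂ) ^ w) = (π : ℂ) ^ conj w := fun w => by
    rw [Complex.cpow_conj _ _ hπarg, Complex.conj_ofReal]
  rw [Complex.Gammaℝ_def, Complex.Gammaℝ_def, map_mul, ← Complex.Gamma_conj, hcpow, map_div₀, map_div₀,
    map_neg, hconj, map_ofNat]

omit hp in
/-- **`conj (Π_{v∈S} L_v(½ − is)) = E_S(s)`**, i.e. `conj ∘ semilocalMultiplier = dualMultiplier` — the one
identity behind Prop. 4.4 ("The proof of (i) and (ii) follows from the equality … `conj L_v(½+is) = L_v(½−is)`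
… combining (48) with (52)").  PROVED. [cite: ConnesConsaniMoscovici2024, proof of Prop. 4.4 §4.4 p. 20 (arXiv chunk p0014:L3–L9)] -/
theorem conj_semilocalMultiplier (s : ℝ) :
    conj (semilocalMultiplier p s) = dualMultiplier p s := by
  unfold semilocalMultiplier dualMultiplier
  rw [map_mul, ← conj_Gammaℝ_half_add, ← conj_eulerFactor, Complex.conj_conj, Complex.conj_conj]

omit hp in
/-- `|E_S(s)| = |Π_v L_v(½ − is)|`: the densities of `ds/|E_S|²` and `dm_S` are inverse to each other.
[cite: ConnesConsaniMoscovici2024, §4.4 p. 20 (arXiv chunk p0013:L91, p0014:L9)] -/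
theorem norm_dualMultiplier (s : ℝ) : ‖dualMultiplier p s‖ = ‖semilocalMultiplier p s‖ := by
  rw [← conj_semilocalMultiplier, Complex.norm_conj]

/-- `Π_v L_v(½ − is) ≠ 0` (`Γ_ℝ` has no zeros on `Re = ½`, `L_p(½ − is) ≠ 0`). [cite: ConnesConsaniMoscovici2024, §4.2 eq. (48) p. 18 (arXiv chunk p0012:L134)] -/
theorem semilocalMultiplier_ne_zero (s : ℝ) : semilocalMultiplier p s ≠ 0 := by
  unfold semilocalMultiplier
  refine mul_ne_zero (Complex.Gammaℝ_ne_zero_of_re_pos ?_) (eulerFactor_ne_zero p s)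
  simp

/-- **Proposition 4.4 (i)** (eq. (54)): "The following equality defines a sesquilinear pairing
`⟨L²(ℝ, ds/|E_S(s)|²) | L²(ℝ, dm_S)⟩`: `⟨ξ|η⟩_ℝ := ∫ ξ(x)conj(η(x))dx`" — the integrand is integrable when
`ξ/E_S ∈ L²(ds)` and `η·(Π_v L_v(½ − i·)) ∈ L²(ds)` (`|E_S| = |Π_v L_v(½ − is)|`, `norm_dualMultiplier`, and
`|ξ conj η| ≤ (|ξ/E_S|² + |η E_S|²)/2`).  PROVED.  RH-FREE.
[cite: ConnesConsaniMoscovici2024, Prop. 4.4 (i) eq. (54) §4.4 p. 20 (arXiv chunk p0013:L105–L109)] -/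
theorem dualPairing_integrable {ξ η : ℝ → ℂ} (hξm : AEStronglyMeasurable ξ volume)
    (hηm : AEStronglyMeasurable η volume)
    (hξ : Integrable (fun s => ‖ξ s / dualMultiplier p s‖ ^ 2))
    (hη : Integrable (fun s => ‖η s * semilocalMultiplier p s‖ ^ 2)) :
    Integrable fun s => ξ s * conj (η s) := by
  refine Integrable.mono' ((hξ.add hη).div_const 2) (hξm.mul (Complex.continuous_conj.comp_aestronglyMeasurable hηm)) ?_
  refine Eventually.of_forall fun s => ?_
  have hE : dualMultiplier p s ≠ 0 := by
    rw [← conj_semilocalMultiplier]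
    exact (map_ne_zero _).mpr (semilocalMultiplier_ne_zero p s)
  have hfac : ξ s * conj (η s) = (ξ s / dualMultiplier p s) * (dualMultiplier p s * conj (η s)) := by
    field_simp
  rw [hfac, norm_mul]
  have hn : ‖dualMultiplier p s * conj (η s)‖ = ‖η s * semilocalMultiplier p s‖ := by
    rw [norm_mul, norm_mul, Complex.norm_conj, norm_dualMultiplier, mul_comm]
  rw [hn]
  simp only [Pi.add_apply]
  nlinarith [sq_nonneg (‖ξ s / dualMultiplier p s‖ - ‖η s * semilocalMultiplier p s‖),
    norm_nonneg (ξ s / dualMultiplier p s), norm_nonneg (η s * semilocalMultiplier p s)]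

/-- **Proposition 4.4 (ii)**, pulled back and at function level: "For any `ξ, η ∈ L²(X_S)^{K_S}` one has
`⟨υ_Sξ | 𝒱_Sη⟩_ℝ = ⟨ξ|η⟩`."  The integrand of `⟨υ_S f | 𝒱_S g⟩_ℝ` equals `𝒰f · conj(𝒰g)`, the integrand of
`⟨𝒰f|𝒰g⟩` — pointwise, because `E_S(s)/conj(Π_v L_v(½ − is)) = 1` (`conj_semilocalMultiplier`); the remaining
step `⟨𝒰f|𝒰g⟩ = ⟨f|g⟩` is the unitarity of `𝒰_S = 𝔽_μ ∘ w_S` (§3.1.4, Mellin–Plancherel; seat t12 / TODO) and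
is not asserted here.  PROVED (the printed proof's identity).  RH-FREE.
[cite: ConnesConsaniMoscovici2024, Prop. 4.4 (ii) §4.4 p. 20 (arXiv chunk p0014:L1–L9)] -/
theorem dualTransform_mul_conj_semilocalV (f g : ℝ → ℂ) (s : ℝ) :
    dualTransform p f s * conj (semilocalV p g s) =
      mellin f (1 / 2 - s * I) * conj (mellin g (1 / 2 - s * I)) := by
  unfold dualTransform betaMul semilocalV semilocalM
  beta_reduce
  rw [map_mul, map_inv₀, conj_semilocalMultiplier]
  have hE : dualMultiplier p s ≠ 0 := by
    rw [← conj_semilocalMultiplier]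
    exact (map_ne_zero _).mpr (semilocalMultiplier_ne_zero p s)
  field_simp

end Dual

/-! ## §4.5 Definition 4.4 — the local Sonin space, archimedean case `K = ℝ` -/

section LocalSonin

/-- **Definition 4.4** for the local field `K = ℝ` with its standard character `e_∞(x) = e^{2πix}`: "The
Sonin space `𝔖_λ(K, α)` is the subspace of … square integrable functions on `K` defined as follows
`𝔖_λ(K, α) := {f ∈ L²(K) | f(x) = 0 & 𝔽_αf(x) = 0 ∀x, |x| < λ}`" (a.e., `𝔽_{e_∞}` = Mathlib's `L²` Fourier
transform `𝓕`, same normalisation (17)).  For `K = ℚ_p` (character `e_p`, eq. (55)) and Prop. 4.5 (`σ_p =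
ε₀ − p⁻¹ε₁` spans the `ℤ_p^*`-invariants of `𝔖_1(ℚ_p, e_p)`, `𝔽σ_p = σ_p`) the definition is NOT typed: Mathlib
has no `L²(ℚ_p)`/`p`-adic Fourier transform (said so; `σ_p` enters the tree only through the position-space
formula of `θ_p`, `ConnesConsani2021.primeTwist_coeFn`).  CC 2021's Sonin space (Def. 4.4 there, tree:
`soninSpace λ λ`) is the EVEN part of `𝔖_λ(ℝ, e_∞)`: `soninSpace_eq_evenPart_inf_localSoninSpace`.
[cite: ConnesConsaniMoscovici2024, Def. 4.4 §4.5 p. 20 (arXiv chunk p0014:L15–L20)] -/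
def localSoninSpace (lam : ℝ) : Submodule ℂ (Lp ℂ 2 (volume : Measure ℝ)) where
  carrier := {f | f ∈ vanishSet (Ioo (-lam) lam) ∧
    (𝓕 f : Lp ℂ 2 (volume : Measure ℝ)) ∈ vanishSet (Ioo (-lam) lam)}
  zero_mem' := by
    refine ⟨(vanishSet _).zero_mem, ?_⟩
    rw [show (𝓕 (0 : Lp ℂ 2 (volume : Measure ℝ)) : Lp ℂ 2 (volume : Measure ℝ)) = 0 from
      FourierTransform.fourier_zero]
    exact (vanishSet _).zero_mem
  add_mem' := by
    rintro f g ⟨hf, hf'⟩ ⟨hg, hg'⟩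
    refine ⟨(vanishSet _).add_mem hf hg, ?_⟩
    rw [show (𝓕 (f + g) : Lp ℂ 2 (volume : Measure ℝ)) = 𝓕 f + 𝓕 g from
      FourierTransform.fourier_add f g]
    exact (vanishSet _).add_mem hf' hg'
  smul_mem' := by
    rintro c f ⟨hf, hf'⟩
    refine ⟨(vanishSet _).smul_mem c hf, ?_⟩
    rw [show (𝓕 (c • f) : Lp ℂ 2 (volume : Measure ℝ)) = c • 𝓕 f from
      FourierTransform.fourier_smul c f]
    exact (vanishSet _).smul_mem c hf'

/-- Membership in `𝔖_λ(ℝ, e_∞)`. [cite: ConnesConsaniMoscovici2024, Def. 4.4 §4.5 p. 20 (arXiv chunk p0014:L15–L20)] -/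
theorem mem_localSoninSpace_iff {lam : ℝ} {f : Lp ℂ 2 (volume : Measure ℝ)} :
    f ∈ localSoninSpace lam ↔
      (∀ᵐ x : ℝ, x ∈ Ioo (-lam) lam → (f : ℝ → ℂ) x = 0) ∧
      (∀ᵐ x : ℝ, x ∈ Ioo (-lam) lam → ((𝓕 f : Lp ℂ 2 (volume : Measure ℝ)) : ℝ → ℂ) x = 0) :=
  Iff.rfl

/-- `|x| < λ` versus `|x| ≤ λ`: the two vanishing conditions agree a.e. (the endpoints are Lebesgue-null), so
the printed strict inequality of Def. 4.4/4.5 and the tree's closed intervals define the same subspaces.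
[cite: ConnesConsaniMoscovici2024, Def. 4.4 §4.5 p. 20 (arXiv chunk p0014:L15–L20)] -/
theorem vanishSet_Ioo_eq_Icc (lam : ℝ) : vanishSet (Ioo (-lam) lam) = vanishSet (Icc (-lam) lam) := by
  ext f
  simp only [mem_vanishSet_iff]
  have hnull : ∀ᵐ x : ℝ, x ≠ -lam ∧ x ≠ lam := by
    have h1 : ∀ᵐ x : ℝ, x ≠ -lam := by
      rw [ae_iff]; simp
    have h2 : ∀ᵐ x : ℝ, x ≠ lam := by
      rw [ae_iff]; simp
    filter_upwards [h1, h2] with x a b using ⟨a, b⟩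
  constructor
  · intro h
    filter_upwards [h, hnull] with x hx hne hxI
    exact hx ⟨lt_of_le_of_ne hxI.1 (Ne.symm hne.1), lt_of_le_of_ne hxI.2 hne.2⟩
  · intro h
    filter_upwards [h] with x hx hxI
    exact hx (Ioo_subset_Icc_self hxI)

/-- **CC 2021's Sonin space is the even part of Def. 4.4's `𝔖_λ(ℝ, e_∞)`**: `soninSpace λ λ = L²(ℝ)_ev ∩
𝔖_λ(ℝ, e_∞)` (tree: `ConnesConsani2021.soninSpace`, `evenPart`).  PROVED (endpoints null).
[cite: ConnesConsaniMoscovici2024, Def. 4.4 §4.5 p. 20 (arXiv chunk p0014:L15); Thm. 4.6 (`𝔖_λ(ℝ, e_∞)`) p. 23] -/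
theorem soninSpace_eq_evenPart_inf_localSoninSpace (lam : ℝ) :
    soninSpace lam lam = evenPart ⊓ localSoninSpace lam := by
  ext f
  rw [Submodule.mem_inf, mem_soninSpace_iff']
  change _ ↔ f ∈ evenPart ∧ (f ∈ vanishSet (Ioo (-lam) lam) ∧
    (𝓕 f : Lp ℂ 2 (volume : Measure ℝ)) ∈ vanishSet (Ioo (-lam) lam))
  rw [vanishSet_Ioo_eq_Icc, ← vanishOn_eq_vanishSet]

end LocalSonin

/-! ## §4.7 The stability of Sonin spaces (pp. 22–23): eq. (58) and Proposition 4.7 -/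

section Stability

variable (p : ℕ) [hp : Fact p.Prime]

/-- **`θ_S` at function level**, `S = {∞, p}`: `(θ_p f)(u) = f(u) − p⁻¹f(u/p)` — the position-space form of
`w_S(σ_S ⊗ f)(1 × λ) = λ^{1/2}(f(λ) − p⁻¹f(λ/p))` (proof of Prop. 4.6 (ii), first display of p. 22 in the tex) and
of the tree's operator `primeTwist` (`ConnesConsani2021.primeTwist_coeFn`).
[cite: ConnesConsaniMoscovici2024, proof of Prop. 4.6 (ii) §4.6 p. 22 (arXiv chunk p0015:L1–L5)] -/
def primeTwistFun (f : ℝ → ℂ) (u : ℝ) : ℂ :=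
  f u - (p : ℂ)⁻¹ * f ((p : ℝ)⁻¹ * u)

/-- The tree's `θ_p` acts as `primeTwistFun` a.e. [cite: ConnesConsaniMoscovici2024, Prop. 4.6 (ii) eq. (57) §4.6 p. 22 (arXiv chunk p0014:L89–L93)] -/
theorem primeTwist_coeFn_eq (ξ : Lp ℂ 2 (volume : Measure ℝ)) :
    (primeTwist p ξ : ℝ → ℂ) =ᵐ[volume] primeTwistFun p (ξ : ℝ → ℂ) :=
  primeTwist_coeFn p ξ

/-- **Eq. (58)** (≡ eq. (57) = Prop. 4.6 (ii), rewritten with `(1 − p^{−½−is})⁻¹ = L_p(½ + is)`): "`𝔽_μ w_S(θ_S(f))(s)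
= (Π_{p∈S∖{∞}} L_p(½ + is))⁻¹ (𝔽_μ w_∞ f)(s)`", `S = {∞, p}`, on the Mellin side:
`mellin (θ_p f) (½ − is) = L_p(½ + is)⁻¹ · mellin f (½ − is)` whenever the Mellin integral of `f` converges
absolutely there (the printed computation `𝔽_μ(g(·/p))(s) = p^{−is}𝔽_μ(g)(s)`).  PROVED.  RH-FREE.
[cite: ConnesConsaniMoscovici2024, §4.7 eq. (58) p. 22 (arXiv chunk p0015:L34–L38); Prop. 4.6 (ii) eq. (57) (chunk p0015:L6–L30)] -/
theorem mellin_primeTwistFun {f : ℝ → ℂ} {s : ℝ} (hf : MellinConvergent f (1 / 2 - s * I)) :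
    mellin (primeTwistFun p f) (1 / 2 - s * I) =
      (eulerFactor p (1 / 2 + s * I))⁻¹ * mellin f (1 / 2 - s * I) := by
  have hp0 : (0 : ℝ) < p := by exact_mod_cast hp.out.pos
  have hpi : (0 : ℝ) < (p : ℝ)⁻¹ := inv_pos.2 hp0
  set z : ℂ := 1 / 2 - s * I with hz
  have hdil : MellinConvergent (fun t => f ((p : ℝ)⁻¹ * t)) z := (MellinConvergent.comp_mul_left hpi).2 hf
  have hsub : mellin (primeTwistFun p f) z =
      mellin f z - (p : ℂ)⁻¹ * mellin (fun t => f ((p : ℝ)⁻¹ * t)) z := by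
    have h := hasMellin_sub hf (hdil.const_smul ((p : ℂ)⁻¹))
    simp only [smul_eq_mul] at h
    rw [show primeTwistFun p f = fun u => f u - (p : ℂ)⁻¹ * f ((p : ℝ)⁻¹ * u) from rfl, h.2,
      show (fun t : ℝ => (p : ℂ)⁻¹ * f ((p : ℝ)⁻¹ * t)) =
        fun t => (p : ℂ)⁻¹ • (fun u : ℝ => f ((p : ℝ)⁻¹ * u)) t from rfl,
      mellin_const_smul, smul_eq_mul]
  rw [hsub, mellin_comp_mul_left f z hpi, smul_eq_mul, eulerFactor, inv_inv]
  have harg : ((p : ℂ)).arg ≠ π := by rw [Complex.natCast_arg]; exact Real.pi_ne_zero.symm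
  have hpow : (Complex.ofReal ((p : ℝ)⁻¹)) ^ (-z) = (p : ℂ) ^ z := by
    rw [Complex.ofReal_inv, Complex.ofReal_natCast, Complex.inv_cpow _ _ harg, Complex.cpow_neg, inv_inv]
  rw [hpow]
  have hsplit : (p : ℂ)⁻¹ * (p : ℂ) ^ z = (p : ℂ) ^ (-(1 / 2 + s * I)) := by
    have hpC : (p : ℂ) ≠ 0 := Nat.cast_ne_zero.mpr hp.out.ne_zero
    have e : -(1 / 2 + (s : ℂ) * I) = z - 1 := by rw [hz]; ring
    conv_rhs => rw [e, Complex.cpow_sub _ _ hpC, Complex.cpow_one]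
    rw [div_eq_mul_inv, mul_comm]
  rw [sub_mul, one_mul, ← mul_assoc, hsplit]

/-- **Proposition 4.7 (i)**, pulled back: "Let `𝔽_S` be the Fourier transform in `L²(X_S)`. One has
`𝔽_S ∘ θ_S = θ_S ∘ 𝔽_{e_ℝ}`" (proof: "This follows from the equality `𝔽_{e_p}σ_p = σ_p`").  With the tree's
`semilocalFourier p = θ_p ∘ 𝓕 ∘ θ_p⁻¹` (which took this intertwining as the definition of the pulled-back
`𝔽_S`): `semilocalFourier p (θ_p ξ) = θ_p (𝓕 ξ)`.  PROVED (by `semilocalFourier_apply`).  RH-FREE.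
[cite: ConnesConsaniMoscovici2024, Prop. 4.7 (i) §4.7 p. 22 (arXiv chunk p0015:L42, proof L60)] -/
theorem semilocalFourier_primeTwist (ξ : Lp ℂ 2 (volume : Measure ℝ)) :
    semilocalFourier p (primeTwist p ξ) = primeTwist p (𝓕 ξ : Lp ℂ 2 (volume : Measure ℝ)) := by
  rw [semilocalFourier_apply]
  congr 2
  rw [← primeTwistEquiv_apply, ContinuousLinearEquiv.symm_apply_apply]

/-- **Proposition 4.7 (ii)** (diagram (59): `υ_S ∘ θ_S = ι'_S ∘ υ_∞`), pulled back and at function level: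
"`υ_S ∘ θ_S(f)(s) = (Π_{v∈S} L_v(½+is))(Π_{p∈S∖{∞}} L_p(½+is))⁻¹(𝔽_μ w_∞ f)(s) = L_∞(½+is)(𝔽_μ w_∞ f)(s) =
υ_∞(f)(s)`" — `dualTransform p (θ_p f) = archDualTransform f` on the critical line, for `f` with absolutely
convergent Mellin integral.  PROVED from eq. (58).  RH-FREE.
[cite: ConnesConsaniMoscovici2024, Prop. 4.7 (ii) diagram (59) §4.7 p. 22 (arXiv chunk p0015:L44–L56, proof L60–L68)] -/
theorem dualTransform_primeTwistFun {f : ℝ → ℂ} {s : ℝ} (hf : MellinConvergent f (1 / 2 - s * I)) :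
    dualTransform p (primeTwistFun p f) s = archDualTransform f s := by
  unfold dualTransform betaMul archDualTransform dualMultiplier archDualMultiplier
  beta_reduce
  rw [mellin_primeTwistFun p hf]
  have hne : eulerFactor p (1 / 2 + s * I) ≠ 0 := by
    have h := eulerFactor_ne_zero p (-s)
    rwa [show (1 / 2 - ((-s : ℝ) : ℂ) * I) = 1 / 2 + s * I by push_cast; ring] at h
  rw [← mul_assoc, mul_assoc (Complex.Gammaℝ _), mul_inv_cancel₀ hne, mul_one]

/-- **`θ_p^* = 1 − D_p`**: `⟪θ_p f, ζ⟫ = ⟪f, ζ − D_p ζ⟫` (adjoint of the dilation, `⟪D_a f, ζ⟫ = |a|⁻¹⟪f, D_{a⁻¹}ζ⟫`,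
tree: `ConnesConsani2021.inner_lpDilation_left`).  The duality between `θ_S` and `η_S` behind Prop. 4.7 (iii).
[cite: ConnesConsaniMoscovici2024, proof of Prop. 4.7 (iii) §4.7 p. 23 (arXiv chunk p0015:L70–L81)] -/
theorem inner_primeTwist_left (f ζ : Lp ℂ 2 (volume : Measure ℝ)) :
    ⟪primeTwist p f, ζ⟫_ℂ = ⟪f, ζ - primeDilation p ζ⟫_ℂ := by
  have hp0 : (0 : ℝ) < p := by exact_mod_cast hp.out.pos
  have hpinv : (p : ℝ)⁻¹ ≠ 0 := inv_ne_zero hp0.ne'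
  have hθ : primeTwist p f = f - (p : ℂ)⁻¹ •
      lpDilation (V := ℝ) (F := ℂ) (p := (2 : ℝ≥0∞)) ((p : ℝ)⁻¹) hpinv ENNReal.ofNat_ne_top f := by
    simp [primeTwist]
  rw [hθ, inner_sub_left, inner_smul_left, inner_lpDilation_left, inner_sub_right]
  have habs : ((|((p : ℝ)⁻¹)|⁻¹ : ℝ) : ℂ) = (p : ℂ) := by
    rw [abs_of_pos (inv_pos.2 hp0), inv_inv, Complex.ofReal_natCast]
  have hscale : lpDilation (V := ℝ) (F := ℂ) (p := (2 : ℝ≥0∞)) ((p : ℝ)⁻¹)⁻¹ (inv_ne_zero hpinv)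
      ENNReal.ofNat_ne_top = primeDilation p := by
    unfold primeDilation
    exact lpDilation_congr (inv_inv _) _ _
  rw [habs, hscale, map_inv₀, Complex.conj_natCast, ← mul_assoc,
    inv_mul_cancel₀ (Nat.cast_ne_zero.mpr hp.out.ne_zero), one_mul]

/-- **Proposition 4.7 (iii)**, pulled back: "Let `f, g ∈ L²(ℝ)^{ev}`. One has `⟨θ_S(f) | η_S(g)⟩ = ⟨f|g⟩`" —
`⟪θ_p f, η_p g⟫ = ⟪f, g⟫` in `L²(ℝ)` (`U` is unitary).  Printed proof: unitarity of `𝒰_S` with (58) and (47);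
here directly from `θ_p^* = 1 − D_p = η_p⁻¹`.  PROVED.  RH-FREE.
[cite: ConnesConsaniMoscovici2024, Prop. 4.7 (iii) §4.7 p. 22 (arXiv chunk p0015:L58, proof L70–L81)] -/
theorem inner_primeTwist_semilocalEta (f g : Lp ℂ 2 (volume : Measure ℝ)) :
    ⟪primeTwist p f, semilocalEta p g⟫_ℂ = ⟪f, g⟫_ℂ := by
  rw [inner_primeTwist_left]
  congr 1
  have h : ((1 - primeDilation p) * semilocalEta p) g = g := by
    rw [one_sub_primeDilation_mul_semilocalEta]; rfl
  exact h

end Stability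







/-! ## Discharge of Theorem 4.1 (ii): the eigenvectors of `N_S` are `η_S(P_n^S e^{−πx²})` -/

section HermiteDischarge

variable (p : ℕ) [hp : Fact p.Prime]

/-- `E_n^S = span{η_p g_k : k ≤ n}`. [cite: ConnesConsaniMoscovici2024, proof of Thm. 4.1 (ii) §4.3 p. 18 (arXiv chunk p0013:L52)] -/
theorem semilocalFiltration_eq_span (n : ℕ) :
    semilocalFiltration p n =
      Submodule.span ℂ ((fun k => semilocalEta p (gaussMonomialVec k)) '' Set.Iic n) := by
  rw [semilocalFiltration, archFiltration, Submodule.map_span, Set.image_image]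
  rfl

/-- `⨆_{k<n} E_k^S = span{η_p g_k : k < n}` (`= E_{n−1}^S`, `= 0` for `n = 0`). [cite: ConnesConsaniMoscovici2024, §4.3 p. 18 (arXiv chunk p0013:L41)] -/
theorem iSup_semilocalFiltration_lt (n : ℕ) :
    (⨆ (k : ℕ) (_ : k < n), semilocalFiltration p k) =
      Submodule.span ℂ ((fun k => semilocalEta p (gaussMonomialVec k)) '' Set.Iio n) := by
  apply le_antisymm
  · refine iSup₂_le fun k hk => ?_
    rw [semilocalFiltration_eq_span]
    exact Submodule.span_mono (Set.image_mono fun j (hj : j ≤ k) => lt_of_le_of_lt hj hk)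
  · refine Submodule.span_le.2 ?_
    rintro _ ⟨j, hj, rfl⟩
    have hle : semilocalFiltration p j ≤ ⨆ (k : ℕ) (_ : k < n), semilocalFiltration p k :=
      le_iSup₂ (f := fun k (_ : k < n) => semilocalFiltration p k) j hj
    apply hle
    rw [semilocalFiltration_eq_span]
    exact Submodule.subset_span ⟨j, Set.self_mem_Iic, rfl⟩

/-- **Theorem 4.1 (ii) discharged**: every layer `E_n^S ⊖ E_{n−1}^S` (eigenspace of `N_S`) is the line spanned
by `η_p(Σ_{k≤n} c_k x^{2k}e^{−πx²})` with `c_n = 1` — Gram–Schmidt: `v = η_pg_n − P_{E_{n−1}^S}(η_pg_n)` and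
`P_{E_{n−1}^S}(η_pg_n) ∈ η_p(span{g_k : k < n})` ("polynomials obtained by orthonormalization and induction …
which depend upon `S`" since `η_S` is not unitary).  RH-FREE.
[cite: ConnesConsaniMoscovici2024, Thm. 4.1 (ii) §4.3 p. 18 (arXiv chunk p0013:L47, proof L52)] -/
theorem ConnesConsaniMoscovici2024_thm_4_1_ii_holds : ConnesConsaniMoscovici2024_thm_4_1_ii p := by
  intro n
  set v : ℕ → Lp ℂ 2 (volume : Measure ℝ) := fun k => semilocalEta p (gaussMonomialVec k) with hv
  set W : Submodule ℂ (Lp ℂ 2 (volume : Measure ℝ)) := Submodule.span ℂ (v '' Set.Iio n) with hWdef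
  set E : Submodule ℂ (Lp ℂ 2 (volume : Measure ℝ)) := Submodule.span ℂ (v '' Set.Iic n) with hEdef
  have hE : semilocalFiltration p n = E := semilocalFiltration_eq_span p n
  have hW : (⨆ (k : ℕ) (_ : k < n), semilocalFiltration p k) = W := iSup_semilocalFiltration_lt p n
  have hWE : W ≤ E := Submodule.span_mono (Set.image_mono Set.Iio_subset_Iic_self)
  -- `W` is finite-dimensional, hence has an orthogonal projection
  haveI : FiniteDimensional ℂ W :=
    FiniteDimensional.span_of_finite ℂ ((Set.finite_Iio n).image v)
  haveI : W.HasOrthogonalProjection := Submodule.HasOrthogonalProjection.ofCompleteSpace W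
  -- decompose `η g_n = y + z`, `y ∈ W`, `z ∈ Wᗮ`
  obtain ⟨y, hy, z, hz, hyz⟩ := Submodule.exists_add_mem_mem_orthogonal (K := W) (v n)
  -- `W = η(span{g_k : k < n})`, so `y = η u` with `u = Σ_{i<n} b_i g_i`
  have hWrange : W = Submodule.span ℂ (Set.range fun i : Fin n => v i) := by
    rw [hWdef]
    congr 1
    ext x
    simp only [Set.mem_image, Set.mem_Iio, Set.mem_range]
    constructor
    · rintro ⟨k, hk, rfl⟩; exact ⟨⟨k, hk⟩, rfl⟩
    · rintro ⟨i, rfl⟩; exact ⟨i, i.2, rfl⟩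
  have hy' : y ∈ Submodule.span ℂ (Set.range fun i : Fin n => v i) := hWrange ▸ hy
  obtain ⟨b, hb⟩ := (Submodule.mem_span_range_iff_exists_fun ℂ).1 hy'
  -- the coefficients: `c_k = -b_k` (`k < n`), `c_n = 1`
  let c : ℕ → ℂ := fun k => if h : k < n then -(b ⟨k, h⟩) else if k = n then 1 else 0
  have hcn : c n = 1 := by simp [c]
  have hcomb : semilocalEta p (gaussComb n c) = z := by
    have hsum : gaussComb n c = gaussMonomialVec n - ∑ i : Fin n, b i • gaussMonomialVec i := by
      rw [gaussComb, Finset.sum_range_succ, hcn, one_smul, Finset.sum_range fun k => c k • gaussMonomialVec k]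
      have : ∑ i : Fin n, c i • gaussMonomialVec i = -(∑ i : Fin n, b i • gaussMonomialVec i) := by
        rw [← Finset.sum_neg_distrib]
        refine Finset.sum_congr rfl fun i _ => ?_
        simp [c, i.2, neg_smul]
      rw [this]; abel
    rw [hsum, map_sub, map_sum]
    simp only [map_smul]
    have hvn : semilocalEta p (gaussMonomialVec n) = v n := rfl
    rw [hvn, hyz, hb]
    abel
  refine ⟨c, by rw [hcn]; exact one_ne_zero, ?_⟩
  rw [semilocalLayer, hE, hW, hcomb]
  -- `E ⊓ Wᗮ = ℂ ∙ z`
  apply le_antisymm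
  · intro x hx
    obtain ⟨hxE, hxW⟩ := Submodule.mem_inf.1 hx
    have hxE' : x ∈ Submodule.span ℂ (insert (v n) (v '' Set.Iio n)) := by
      rw [← Set.image_insert_eq, Set.Iio_insert]; exact hxE
    obtain ⟨a, w, hw, hxaw⟩ := Submodule.mem_span_insert.1 hxE'
    have hdiff : x - a • z ∈ W ⊓ Wᗮ := by
      refine Submodule.mem_inf.2 ⟨?_, Submodule.sub_mem _ hxW (Submodule.smul_mem _ a hz)⟩
      have : x - a • z = a • y + w := by
        rw [hxaw, hyz, smul_add]; abel
      rw [this]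
      exact Submodule.add_mem _ (Submodule.smul_mem _ a hy) hw
    rw [Submodule.inf_orthogonal_eq_bot, Submodule.mem_bot, sub_eq_zero] at hdiff
    rw [hdiff]
    exact Submodule.smul_mem _ a (Submodule.mem_span_singleton_self z)
  · rw [Submodule.span_singleton_le_iff_mem]
    refine Submodule.mem_inf.2 ⟨?_, hz⟩
    have hz' : z = v n - y := by rw [hyz]; abel
    rw [hz']
    exact Submodule.sub_mem _ (Submodule.subset_span ⟨n, Set.self_mem_Iic, rfl⟩) (hWE hy)

end HermiteDischarge

/-! ## Discharge of Theorem 4.1 (iii): the matrix of `ϑ_S` in the eigenbasis of `N_S` is a Jacobi matrix -/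

section JacobiDischarge

variable (p : ℕ) [hp : Fact p.Prime]

/-- `D_p^i g_j = g_j(p^i ·)` a.e. (`g_j = x^{2j}e^{−πx²}`) — the terms of `η_S(P(x)e^{−πx²})` (eq. (44)).
[cite: ConnesConsaniMoscovici2024, §4.2 eq. (44) p. 16 (arXiv chunk p0012:L74); proof of Thm. 4.1 (ii) §4.3 p. 18 (arXiv chunk p0013:L52)] -/
theorem primeDilation_pow_gaussMonomialVec_coeFn (i j : ℕ) :
    (((primeDilation p ^ i) (gaussMonomialVec j) : Lp ℂ 2 (volume : Measure ℝ)) : ℝ → ℂ)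
      =ᵐ[volume] fun x => gaussMonomialFun j ((p : ℝ) ^ i * x) := by
  rw [primeDilation_pow]
  refine (lpDilation_coeFn (V := ℝ) (F := ℂ) (p := (2 : ℝ≥0∞)) _ _ _).trans ?_
  have h := ae_eq_comp_smul (V := ℝ) (MemLp.coeFn_toLp (memLp_gaussMonomialFun j))
    (a := (p : ℝ) ^ i) (pow_ne_zero i (prime_cast_ne_zero p))
  simpa only [gaussMonomialVec, smul_eq_mul] using h


/-- **The Gram matrix of the dilated Gaussian monomials, entrywise**:
`⟪D_p^i g_j, D_p^l g_k⟫ = p^{2ij+2lk} ∫ x^{2(j+k)} e^{−π(p^{2i}+p^{2l})x²} dx` (a real Gaussian moment) — the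
scalar products entering the orthonormalisation in `E_n^S` (proof of Thm. 4.1 (ii): "`η_S` is not unitary, the
polynomials depend upon `S`").  [cite: ConnesConsaniMoscovici2024, proof of Thm. 4.1 (ii) §4.3 p. 18 (arXiv chunk p0013:L52)] -/
theorem inner_primeDilation_pow_gaussMonomialVec (i l j k : ℕ) :
    ⟪(primeDilation p ^ i) (gaussMonomialVec j), (primeDilation p ^ l) (gaussMonomialVec k)⟫_ℂ =
      (((p : ℝ) ^ (2 * i * j + 2 * l * k) *
        ∫ x : ℝ, x ^ (2 * (j + k)) *
          Real.exp (-(π * ((p : ℝ) ^ (2 * i) + (p : ℝ) ^ (2 * l))) * x ^ 2) : ℝ) : ℂ) := by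
  rw [MeasureTheory.L2.inner_def]
  have hae : (fun x : ℝ =>
      ⟪(((primeDilation p ^ i) (gaussMonomialVec j) : Lp ℂ 2 (volume : Measure ℝ)) : ℝ → ℂ) x,
        (((primeDilation p ^ l) (gaussMonomialVec k) : Lp ℂ 2 (volume : Measure ℝ)) : ℝ → ℂ) x⟫_ℂ)
      =ᵐ[volume] fun x => (((p : ℝ) ^ (2 * i * j + 2 * l * k) * (x ^ (2 * (j + k)) *
          Real.exp (-(π * ((p : ℝ) ^ (2 * i) + (p : ℝ) ^ (2 * l))) * x ^ 2)) : ℝ) : ℂ) := by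
    filter_upwards [primeDilation_pow_gaussMonomialVec_coeFn p i j,
      primeDilation_pow_gaussMonomialVec_coeFn p l k] with x h1 h2
    rw [h1, h2, gaussMonomialFun, gaussMonomialFun, RCLike.inner_apply', conj_ofReal, ← ofReal_mul]
    congr 1
    have hexp : Real.exp (-(π * ((p : ℝ) ^ i * x) ^ 2)) * Real.exp (-(π * ((p : ℝ) ^ l * x) ^ 2)) =
        Real.exp (-(π * ((p : ℝ) ^ (2 * i) + (p : ℝ) ^ (2 * l))) * x ^ 2) := by
      rw [← Real.exp_add]
      congr 1
      ring
    calc ((p : ℝ) ^ i * x) ^ (2 * j) * Real.exp (-(π * ((p : ℝ) ^ i * x) ^ 2)) *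
          (((p : ℝ) ^ l * x) ^ (2 * k) * Real.exp (-(π * ((p : ℝ) ^ l * x) ^ 2)))
        = ((p : ℝ) ^ i * x) ^ (2 * j) * ((p : ℝ) ^ l * x) ^ (2 * k) *
            (Real.exp (-(π * ((p : ℝ) ^ i * x) ^ 2)) * Real.exp (-(π * ((p : ℝ) ^ l * x) ^ 2))) := by
          ring
      _ = _ := by rw [hexp]; ring
  rw [integral_congr_ae hae, integral_complex_ofReal, integral_const_mul]

/-- The even Gaussian moments `∫_ℝ x^{2K}e^{−Bx²}dx = B^{−(2K+1)/2}Γ((2K+1)/2)` (`B > 0`; Mathlib's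
`integral_rpow_mul_exp_neg_mul_rpow` on `(0, ∞)`, doubled) — the normalisations of the Gaussian polynomials
`e^{−πx²}x^k` of §3.4.  [cite: ConnesConsaniMoscovici2024, §3.4 p. 12 (arXiv chunk p0009:L44–L48)] -/
theorem integral_pow_mul_exp_neg_mul_sq (K : ℕ) {B : ℝ} (hB : 0 < B) :
    ∫ x : ℝ, x ^ (2 * K) * Real.exp (-B * x ^ 2) =
      B ^ (-((2 * K + 1 : ℝ)) / 2) * Real.Gamma ((2 * K + 1) / 2) := by
  have h1 := integral_comp_abs (f := fun y : ℝ => y ^ (2 * K) * Real.exp (-B * y ^ 2))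
  simp only [Even.pow_abs (even_two_mul K), sq_abs] at h1
  rw [h1]
  have h2 : ∫ x in Ioi (0:ℝ), x ^ (2 * K) * Real.exp (-B * x ^ 2) =
      ∫ x in Ioi (0:ℝ), x ^ ((2 * K : ℕ) : ℝ) * Real.exp (-B * x ^ (2:ℝ)) := by
    refine setIntegral_congr_fun measurableSet_Ioi fun x _ => ?_
    simp only [Real.rpow_natCast, Real.rpow_two]
  have hK : (-1 : ℝ) < ((2 * K : ℕ) : ℝ) := by
    have : (0 : ℝ) ≤ ((2 * K : ℕ) : ℝ) := by positivity
    linarith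
  rw [h2, _root_.integral_rpow_mul_exp_neg_mul_rpow two_pos hK hB]
  push_cast
  ring_nf

/-- **The moment recursion `(2K+1)M_K = 2B·M_{K+1}`** — integrated form of `H(e^{−Bx²}x^{2K}) =
e^{−Bx²}x^{2K}(−2Bx² + 2K)`, `H = x∂_x` (§3.4: "`H(e^{−πx²}x^k) = e^{−πx²}x^k(−2πx² + k)`"), i.e. the
skew-symmetry `∫((H+½)u)v = −∫u(H+½)v` on Gaussian monomials that makes `ϑ = −i(H+½)` symmetric (§3.2).
[cite: ConnesConsaniMoscovici2024, §3.4 p. 12 (arXiv chunk p0009:L44–L48); §3.2 p. 10 (arXiv chunk p0008:L63)] -/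
theorem gaussMoment_rec (K : ℕ) {B : ℝ} (hB : 0 < B) :
    (2 * K + 1) * ∫ x : ℝ, x ^ (2 * K) * Real.exp (-B * x ^ 2) =
      2 * B * ∫ x : ℝ, x ^ (2 * (K + 1)) * Real.exp (-B * x ^ 2) := by
  rw [integral_pow_mul_exp_neg_mul_sq K hB, integral_pow_mul_exp_neg_mul_sq (K + 1) hB]
  have hΓ : Real.Gamma ((2 * ((K + 1 : ℕ) : ℝ) + 1) / 2) =
      ((2 * K + 1) / 2) * Real.Gamma ((2 * K + 1) / 2) := by
    push_cast
    rw [show (2 * ((K:ℝ) + 1) + 1) / 2 = (2 * K + 1) / 2 + 1 by ring]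
    exact Real.Gamma_add_one (by positivity)
  have hB' : B ^ (-((2 * ((K + 1 : ℕ) : ℝ) + 1 : ℝ)) / 2) = B ^ (-((2 * K + 1 : ℝ)) / 2) * B⁻¹ := by
    push_cast
    rw [show -(2 * ((K:ℝ) + 1) + 1) / 2 = -((2 * K + 1 : ℝ)) / 2 + (-1) by ring, Real.rpow_add hB,
      Real.rpow_neg_one]
  rw [hΓ, hB']
  field_simp

/-- **`ϑ` is symmetric between dilated Gaussian monomials** (termwise in `η_p = Σ_i D_p^i`):
`((2j+½)+(2k+½))⟪D^ig_j, D^lg_k⟫ = 2π(⟪D^ig_{j+1}, D^lg_k⟫ + ⟪D^ig_j, D^lg_{k+1}⟫)` — `ϑ` commutes with the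
dilations ("the scaling operator commutes with `η_S`", proof of Thm. 4.1 (ii)) and `H + ½` is skew-symmetric
(the moment recursion at `B = π(p^{2i}+p^{2l})`).  [cite: ConnesConsaniMoscovici2024, proof of Thm. 4.1 (ii) §4.3 p. 18 (arXiv chunk p0013:L52); §3.4 p. 12 (arXiv chunk p0009:L44–L48)] -/
theorem skew_termwise (i l j k : ℕ) :
    ((2 * j + 1 / 2 : ℂ) + (2 * k + 1 / 2)) *
        ⟪(primeDilation p ^ i) (gaussMonomialVec j), (primeDilation p ^ l) (gaussMonomialVec k)⟫_ℂ =
      2 * π * (⟪(primeDilation p ^ i) (gaussMonomialVec (j + 1)),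
          (primeDilation p ^ l) (gaussMonomialVec k)⟫_ℂ +
        ⟪(primeDilation p ^ i) (gaussMonomialVec j), (primeDilation p ^ l) (gaussMonomialVec (k + 1))⟫_ℂ) := by
  simp only [inner_primeDilation_pow_gaussMonomialVec]
  have e1 : 2 * (j + 1 + k) = 2 * ((j + k) + 1) := by ring
  have e2 : 2 * (j + (k + 1)) = 2 * ((j + k) + 1) := by ring
  rw [e1, e2]
  have hp0 : (0 : ℝ) < p := by exact_mod_cast hp.out.pos
  have hBpos : 0 < π * ((p : ℝ) ^ (2 * i) + (p : ℝ) ^ (2 * l)) :=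
    mul_pos Real.pi_pos (add_pos (pow_pos hp0 _) (pow_pos hp0 _))
  have hrec := gaussMoment_rec (j + k) hBpos
  have hrecC := congrArg (fun r : ℝ => (r : ℂ)) hrec
  push_cast at hrecC ⊢
  linear_combination ((p : ℂ) ^ (2 * i * j + 2 * l * k)) * hrecC

/-- `⟪u, η_p v⟫ = Σ_l ⟪u, D_p^l v⟫` (`η_S = Σ_{Γ_+ ∩ ℤ}`, eq. (44), summed inside the scalar product).
[cite: ConnesConsaniMoscovici2024, §4.2 eq. (44) p. 16 (arXiv chunk p0012:L74)] -/
theorem hasSum_inner_primeDilation_pow_right (u v : Lp ℂ 2 (volume : Measure ℝ)) :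
    HasSum (fun l : ℕ => ⟪u, (primeDilation p ^ l) v⟫_ℂ) ⟪u, semilocalEta p v⟫_ℂ := by
  have h := ((hasSum_semilocalEta p).mapL
    (ContinuousLinearMap.apply ℂ (Lp ℂ 2 (volume : Measure ℝ)) v)).mapL (innerSL ℂ u)
  simpa only [ContinuousLinearMap.apply_apply, innerSL_apply_apply] using h

/-- `⟪η_p u, v⟫ = Σ_i ⟪D_p^i u, v⟫` (eq. (44) summed inside the scalar product). [cite: ConnesConsaniMoscovici2024, §4.2 eq. (44) p. 16 (arXiv chunk p0012:L74)] -/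
theorem hasSum_inner_primeDilation_pow_left (u v : Lp ℂ 2 (volume : Measure ℝ)) :
    HasSum (fun i : ℕ => ⟪(primeDilation p ^ i) u, v⟫_ℂ) ⟪semilocalEta p u, v⟫_ℂ := by
  have h := (hasSum_inner_primeDilation_pow_right p v u).star
  simpa only [Complex.star_def, inner_conj_symm] using h

/-- **The three-term (Jacobi) relation of the Gram matrix** `r_{jk} = ⟪η_pg_j, η_pg_k⟫`:
`(2j+2k+1)·r_{jk} = 2π(r_{j+1,k} + r_{j,k+1})` — the scalar form of "`Dξ_n = a_{n−1}ξ_{n−1} + a_nξ_{n+1}`"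
(eq. (6)) for `D = ϑ_S` on `E_n^S`: symmetry of `ϑ_S` on the `η_S`-image of the Gaussian polynomials.
[cite: ConnesConsaniMoscovici2024, Thm. 4.1 (iii) §4.3 p. 18 (arXiv chunk p0013:L49, proof L52); §2.2 eq. (6) p. 6] -/
theorem threeTerm_inner_semilocalEta_gaussMonomialVec (j k : ℕ) :
    ((2 * j + 1 / 2 : ℂ) + (2 * k + 1 / 2)) *
        ⟪semilocalEta p (gaussMonomialVec j), semilocalEta p (gaussMonomialVec k)⟫_ℂ =
      2 * π * (⟪semilocalEta p (gaussMonomialVec (j + 1)), semilocalEta p (gaussMonomialVec k)⟫_ℂ +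
        ⟪semilocalEta p (gaussMonomialVec j), semilocalEta p (gaussMonomialVec (k + 1))⟫_ℂ) := by
  have lvl1 : ∀ i : ℕ, ((2 * j + 1 / 2 : ℂ) + (2 * k + 1 / 2)) *
        ⟪(primeDilation p ^ i) (gaussMonomialVec j), semilocalEta p (gaussMonomialVec k)⟫_ℂ =
      2 * π * (⟪(primeDilation p ^ i) (gaussMonomialVec (j + 1)),
          semilocalEta p (gaussMonomialVec k)⟫_ℂ +
        ⟪(primeDilation p ^ i) (gaussMonomialVec j), semilocalEta p (gaussMonomialVec (k + 1))⟫_ℂ) := by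
    intro i
    have hL := (hasSum_inner_primeDilation_pow_right p ((primeDilation p ^ i) (gaussMonomialVec j))
      (gaussMonomialVec k)).mul_left (((2 * j + 1 / 2 : ℂ) + (2 * k + 1 / 2)))
    have hR := ((hasSum_inner_primeDilation_pow_right p
        ((primeDilation p ^ i) (gaussMonomialVec (j + 1))) (gaussMonomialVec k)).add
      (hasSum_inner_primeDilation_pow_right p ((primeDilation p ^ i) (gaussMonomialVec j))
        (gaussMonomialVec (k + 1)))).mul_left (2 * π : ℂ)
    refine hL.unique ?_
    convert hR using 1
    funext l
    exact skew_termwise p i l j k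
  have hL := (hasSum_inner_primeDilation_pow_left p (gaussMonomialVec j)
    (semilocalEta p (gaussMonomialVec k))).mul_left (((2 * j + 1 / 2 : ℂ) + (2 * k + 1 / 2)))
  have hR := ((hasSum_inner_primeDilation_pow_left p (gaussMonomialVec (j + 1))
      (semilocalEta p (gaussMonomialVec k))).add
    (hasSum_inner_primeDilation_pow_left p (gaussMonomialVec j)
      (semilocalEta p (gaussMonomialVec (k + 1))))).mul_left (2 * π : ℂ)
  refine hL.unique ?_
  convert hR using 1
  funext i
  exact lvl1 i

omit hp in
/-- A series of reals has a real sum. [folklore] -/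
private theorem im_eq_zero_of_hasSum {f : ℕ → ℂ} {a : ℂ} (h : HasSum f a)
    (hf : ∀ n, (f n).im = 0) : a.im = 0 := by
  have h2 := ((Complex.hasSum_iff f a).mp h).2
  simp only [hf] at h2
  exact h2.unique hasSum_zero

/-- **The Gram matrix `⟪η_pg_j, η_pg_k⟫` is real** (every `D_p^ig_j` is real-valued) — the reality behind
"Jacobi hermitian matrix" in Thm. 4.1 (iii).  [cite: ConnesConsaniMoscovici2024, Thm. 4.1 (iii) §4.3 p. 18 (arXiv chunk p0013:L49, proof L52)] -/
theorem im_inner_semilocalEta_gaussMonomialVec (j k : ℕ) :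
    (⟪semilocalEta p (gaussMonomialVec j), semilocalEta p (gaussMonomialVec k)⟫_ℂ).im = 0 := by
  refine im_eq_zero_of_hasSum (hasSum_inner_primeDilation_pow_left p (gaussMonomialVec j)
    (semilocalEta p (gaussMonomialVec k))) fun i => ?_
  refine im_eq_zero_of_hasSum (hasSum_inner_primeDilation_pow_right p
    ((primeDilation p ^ i) (gaussMonomialVec j)) (gaussMonomialVec k)) fun l => ?_
  rw [inner_primeDilation_pow_gaussMonomialVec]
  exact Complex.ofReal_im _

/-- `conj ⟪η_pg_j, η_pg_k⟫ = ⟪η_pg_j, η_pg_k⟫`. [cite: ConnesConsaniMoscovici2024, Thm. 4.1 (iii) §4.3 p. 18 (arXiv chunk p0013:L49, proof L52)] -/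
theorem conj_inner_semilocalEta_gaussMonomialVec (j k : ℕ) :
    conj ⟪semilocalEta p (gaussMonomialVec j), semilocalEta p (gaussMonomialVec k)⟫_ℂ =
      ⟪semilocalEta p (gaussMonomialVec j), semilocalEta p (gaussMonomialVec k)⟫_ℂ :=
  Complex.conj_eq_iff_im.mpr (im_inner_semilocalEta_gaussMonomialVec p j k)

/-- `η_p(Σ_{k≤n} c_k g_k) = Σ_{k≤n} c_k η_pg_k`. [cite: ConnesConsaniMoscovici2024, proof of Thm. 4.1 (ii) §4.3 p. 18 (arXiv chunk p0013:L52)] -/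
theorem semilocalEta_gaussComb (n : ℕ) (c : ℕ → ℂ) :
    semilocalEta p (gaussComb n c) =
      ∑ k ∈ Finset.range (n + 1), c k • semilocalEta p (gaussMonomialVec k) := by
  simp only [gaussComb, map_sum, map_smul]

/-- Sesquilinear expansion of `⟪η_pG(M, a), η_pG(N, b)⟫` against the Gram matrix `⟪η_pg_j, η_pg_k⟫`.
[cite: ConnesConsaniMoscovici2024, proof of Thm. 4.1 (ii) §4.3 p. 18 (arXiv chunk p0013:L52)] -/
theorem inner_semilocalEta_gaussComb (M N : ℕ) (a b : ℕ → ℂ) :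
    ⟪semilocalEta p (gaussComb M a), semilocalEta p (gaussComb N b)⟫_ℂ =
      ∑ j ∈ Finset.range (M + 1), ∑ k ∈ Finset.range (N + 1),
        conj (a j) * b k *
          ⟪semilocalEta p (gaussMonomialVec j), semilocalEta p (gaussMonomialVec k)⟫_ℂ := by
  simp only [semilocalEta_gaussComb, sum_inner, inner_sum, inner_smul_left, inner_smul_right,
    Finset.mul_sum]
  rw [Finset.sum_comm]
  exact Finset.sum_congr rfl fun j _ => Finset.sum_congr rfl fun k _ => by ring

omit hp in
/-- **`ϑ` on a Gaussian polynomial**, over the monomials: for `c_{M+1} = 0`,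
`Σ_{k≤M+1} (ϑc)_k g_k = Σ_{j≤M} c_j(−i(2j+½)g_j + 2πi·g_{j+1})` (§3.4: "`H(e^{−πx²}x^k) = e^{−πx²}x^k(−2πx²+k)`",
`ϑ = −i(H+½)`).  [cite: ConnesConsaniMoscovici2024, §3.4 p. 12 (arXiv chunk p0009:L44–L48); §3.2 p. 10 (arXiv chunk p0008:L63)] -/
theorem gaussComb_succ_scalingGenCoeff (M : ℕ) (c : ℕ → ℂ) (hc : c (M + 1) = 0) :
    gaussComb (M + 1) (scalingGenCoeff c) =
      ∑ j ∈ Finset.range (M + 1), c j •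
        ((-(I * (2 * j + 1 / 2))) • gaussMonomialVec j +
          ((2 * π : ℂ) * I) • gaussMonomialVec (j + 1)) := by
  have hR : ∑ j ∈ Finset.range (M + 1), c j •
        ((-(I * (2 * j + 1 / 2))) • gaussMonomialVec j +
          ((2 * π : ℂ) * I) • gaussMonomialVec (j + 1)) =
      ∑ k ∈ Finset.range (M + 2), (c k * (-(I * (2 * k + 1 / 2)))) • gaussMonomialVec k +
        ∑ k ∈ Finset.range (M + 2),
          ((if k = 0 then 0 else c (k - 1)) * ((2 * π : ℂ) * I)) • gaussMonomialVec k := by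
    simp only [smul_add, smul_smul, Finset.sum_add_distrib]
    congr 1
    · rw [Finset.sum_range_succ _ (M + 1), hc, zero_mul, zero_smul, add_zero]
    · rw [Finset.sum_range_succ' _ (M + 1)]
      simp
  rw [hR, ← Finset.sum_add_distrib, gaussComb]
  refine Finset.sum_congr rfl fun k _ => ?_
  rw [← add_smul]
  congr 1
  unfold scalingGenCoeff
  split_ifs <;> ring

/-- **`ϑ_S` is symmetric on the monomials of `E_n^S`**: `⟪η_p(ϑg_j), η_pg_k⟫ = ⟪η_pg_j, η_p(ϑg_k)⟫` (the three-term
relation, rearranged).  [cite: ConnesConsaniMoscovici2024, Thm. 4.1 (iii) §4.3 p. 18 (arXiv chunk p0013:L49, proof L52); §3.2 p. 10 (arXiv chunk p0008:L63)] -/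
theorem inner_semilocalEta_theta_symm_mono (j k : ℕ) :
    ⟪semilocalEta p ((-(I * (2 * j + 1 / 2))) • gaussMonomialVec j +
        ((2 * π : ℂ) * I) • gaussMonomialVec (j + 1)), semilocalEta p (gaussMonomialVec k)⟫_ℂ =
      ⟪semilocalEta p (gaussMonomialVec j), semilocalEta p ((-(I * (2 * k + 1 / 2))) •
        gaussMonomialVec k + ((2 * π : ℂ) * I) • gaussMonomialVec (k + 1))⟫_ℂ := by
  have h3 := threeTerm_inner_semilocalEta_gaussMonomialVec p j k
  simp only [map_add, map_smul, inner_add_left, inner_add_right, inner_smul_left, inner_smul_right]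
  simp only [map_neg, map_mul, map_add, map_div₀, map_one, Complex.conj_I, map_ofNat, map_natCast,
    Complex.conj_ofReal]
  linear_combination I * h3

/-- **Symmetry of `ϑ_S` on the `η_S`-image of the Gaussian polynomials** (the core `⋃_n E_n^S`):
`⟪ϑ_S η_pG(M,c), η_pG(N,d)⟫ = ⟪η_pG(M,c), ϑ_S η_pG(N,d)⟫` for `c_{M+1} = d_{N+1} = 0` — `ϑ_S` self-adjoint generator of
the scaling action restricted to its invariant core ("the scaling operator commutes with `η_S`").
[cite: ConnesConsaniMoscovici2024, Thm. 4.1 (iii) §4.3 p. 18 (arXiv chunk p0013:L49, proof L52); §3.2 p. 10 (arXiv chunk p0008:L63)] -/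
theorem inner_semilocalEta_theta_symm (M N : ℕ) (c d : ℕ → ℂ) (hc : c (M + 1) = 0)
    (hd : d (N + 1) = 0) :
    ⟪semilocalEta p (gaussComb (M + 1) (scalingGenCoeff c)), semilocalEta p (gaussComb N d)⟫_ℂ =
      ⟪semilocalEta p (gaussComb M c),
        semilocalEta p (gaussComb (N + 1) (scalingGenCoeff d))⟫_ℂ := by
  rw [gaussComb_succ_scalingGenCoeff M c hc, gaussComb_succ_scalingGenCoeff N d hd, gaussComb,
    gaussComb]
  simp only [map_sum, map_smul, sum_inner, inner_sum, inner_smul_left, inner_smul_right]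
  refine Finset.sum_congr rfl fun j _ => ?_
  congr 1
  refine Finset.sum_congr rfl fun k _ => ?_
  rw [inner_semilocalEta_theta_symm_mono]


/-- `η_pG(n, c) ∈ E_n^S`. [cite: ConnesConsaniMoscovici2024, proof of Thm. 4.1 (ii) §4.3 p. 18 (arXiv chunk p0013:L52)] -/
theorem semilocalEta_gaussComb_mem (n : ℕ) (c : ℕ → ℂ) :
    semilocalEta p (gaussComb n c) ∈ semilocalFiltration p n := by
  rw [semilocalFiltration_eq_span, semilocalEta_gaussComb]
  exact Submodule.sum_mem _ fun k hk =>
    Submodule.smul_mem _ _ (Submodule.subset_span ⟨k, Finset.mem_range_succ_iff.mp hk, rfl⟩)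

/-- Every vector of `E_n^S` is `η_p(Σ_{k≤n} d_k g_k)` with `d` supported in `k ≤ n` ("`E_n^S` is the image by `η_S` of
the space of products `P(x)e^{−πx²}`, `P` even of degree `≤ 2n`").  [cite: ConnesConsaniMoscovici2024, proof of Thm. 4.1 (ii) §4.3 p. 18 (arXiv chunk p0013:L52)] -/
theorem exists_eq_semilocalEta_gaussComb {n : ℕ} {v : Lp ℂ 2 (volume : Measure ℝ)}
    (hv : v ∈ semilocalFiltration p n) :
    ∃ d : ℕ → ℂ, (∀ k, n < k → d k = 0) ∧ v = semilocalEta p (gaussComb n d) := by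
  rw [semilocalFiltration_eq_span] at hv
  have hrange : (fun k => semilocalEta p (gaussMonomialVec k)) '' Set.Iic n =
      Set.range fun i : Fin (n + 1) => semilocalEta p (gaussMonomialVec i) := by
    ext x
    simp only [Set.mem_image, Set.mem_Iic, Set.mem_range]
    constructor
    · rintro ⟨k, hk, rfl⟩; exact ⟨⟨k, Nat.lt_succ_of_le hk⟩, rfl⟩
    · rintro ⟨i, rfl⟩; exact ⟨i, Nat.le_of_lt_succ i.2, rfl⟩
  rw [hrange] at hv
  obtain ⟨b, hb⟩ := (Submodule.mem_span_range_iff_exists_fun ℂ).1 hv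
  refine ⟨fun k => if h : k < n + 1 then b ⟨k, h⟩ else 0, fun k hk => by
    simp [show ¬ k < n + 1 by omega], ?_⟩
  rw [semilocalEta_gaussComb, Finset.sum_range (fun k =>
    (if h : k < n + 1 then b ⟨k, h⟩ else 0) • semilocalEta p (gaussMonomialVec k)), ← hb]
  exact Finset.sum_congr rfl fun i _ => by simp [i.2]

omit hp in
/-- Pointwise form of a Gaussian combination. [folklore] -/
private theorem coeFn_sum_smul_gaussMonomialVec (s : Finset ℕ) (c : ℕ → ℂ) :
    ((∑ k ∈ s, c k • gaussMonomialVec k : Lp ℂ 2 (volume : Measure ℝ)) : ℝ → ℂ) =ᵐ[volume]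
      fun x => ∑ k ∈ s, c k * gaussMonomialFun k x := by
  induction s using Finset.induction_on with
  | empty =>
    simp only [Finset.sum_empty]
    exact Lp.coeFn_zero ℂ 2 volume
  | insert a s ha ih =>
    rw [Finset.sum_insert ha]
    refine (Lp.coeFn_add _ _).trans ?_
    filter_upwards [ih, Lp.coeFn_smul (c a) (gaussMonomialVec a),
      MemLp.coeFn_toLp (memLp_gaussMonomialFun a)] with x hx hs hg
    rw [Pi.add_apply, hx, hs, Pi.smul_apply, Finset.sum_insert ha, smul_eq_mul]
    congr 1
    rw [← hg]
    rfl

omit hp in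
/-- **Linear independence of the Gaussian monomials**: `Σ_{k≤m} c_k x^{2k}e^{−πx²} = 0` in `L²` forces
`c_k = 0` for `k ≤ m` (continuity, then the even polynomial `Σ c_kX^{2k}` has infinitely many roots) — `dim E_n = n + 1`
(§3.3: "`E_n` … formed of the even functions `e^{−πx²}P(x)`, `P` even of degree `≤ 2n`").
[cite: ConnesConsaniMoscovici2024, §3.3 p. 11 (arXiv chunk p0008:L121)] -/
theorem eq_zero_of_gaussComb_eq_zero {m : ℕ} {c : ℕ → ℂ} (h : gaussComb m c = 0) :
    ∀ k, k ≤ m → c k = 0 := by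
  have hae := coeFn_sum_smul_gaussMonomialVec (Finset.range (m + 1)) c
  rw [← gaussComb, h] at hae
  set F : ℝ → ℂ := fun x => ∑ k ∈ Finset.range (m + 1), c k * gaussMonomialFun k x with hFdef
  have hcont : Continuous F :=
    continuous_finsetSum _ fun k _ => continuous_const.mul (continuous_gaussMonomialFun k)
  have hF : F = 0 :=
    (Continuous.ae_eq_iff_eq volume hcont continuous_zero).mp
      (hae.symm.trans (Lp.coeFn_zero ℂ 2 volume))
  -- the even polynomial `Σ c_k X^{2k}` vanishes on `ℝ`, hence is zero
  set P : Polynomial ℂ := ∑ k ∈ Finset.range (m + 1), Polynomial.C (c k) * Polynomial.X ^ (2 * k)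
    with hPdef
  have hroot : ∀ x : ℝ, P.IsRoot (x : ℂ) := by
    intro x
    have hx := congrFun hF x
    simp only [hFdef, Pi.zero_apply, gaussMonomialFun] at hx
    rw [Polynomial.IsRoot, hPdef, Polynomial.eval_finsetSum]
    simp only [Polynomial.eval_mul, Polynomial.eval_C, Polynomial.eval_pow, Polynomial.eval_X]
    have hexp : (Real.exp (-(π * x ^ 2)) : ℂ) ≠ 0 := ofReal_ne_zero.mpr (Real.exp_pos _).ne'
    have : (Real.exp (-(π * x ^ 2)) : ℂ) * ∑ k ∈ Finset.range (m + 1), c k * (x : ℂ) ^ (2 * k) = 0 := by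
      rw [Finset.mul_sum, ← hx]
      refine Finset.sum_congr rfl fun k _ => ?_
      push_cast
      ring
    exact (mul_eq_zero.mp this).resolve_left hexp
  have hinf : {z : ℂ | P.IsRoot z}.Infinite :=
    (Set.infinite_range_of_injective Complex.ofReal_injective).mono
      (by rintro _ ⟨x, rfl⟩; exact hroot x)
  have hP : P = 0 := Polynomial.eq_zero_of_infinite_isRoot P hinf
  intro k hk
  have hcoeff := congrArg (fun q : Polynomial ℂ => q.coeff (2 * k)) hP
  simp only [hPdef, Polynomial.finsetSum_coeff, Polynomial.coeff_C_mul_X_pow,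
    Polynomial.coeff_zero] at hcoeff
  simp_rw [mul_right_inj' (two_ne_zero' ℕ)] at hcoeff
  rw [Finset.sum_ite_eq] at hcoeff
  simpa [Finset.mem_range, Nat.lt_succ_of_le hk] using hcoeff

omit hp in
/-- Linearity of `c ↦ Σ_{k≤n} c_k g_k` (difference). [cite: ConnesConsaniMoscovici2024, proof of Thm. 4.1 (ii) §4.3 p. 18 (arXiv chunk p0013:L52)] -/
theorem gaussComb_sub (n : ℕ) (c d : ℕ → ℂ) :
    gaussComb n c - gaussComb n d = gaussComb n (fun k => c k - d k) := by
  simp only [gaussComb, sub_smul, Finset.sum_sub_distrib]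

omit hp in
/-- Linearity of `c ↦ Σ_{k≤n} c_k g_k` (scalars). [cite: ConnesConsaniMoscovici2024, proof of Thm. 4.1 (ii) §4.3 p. 18 (arXiv chunk p0013:L52)] -/
theorem gaussComb_smul (n : ℕ) (a : ℂ) (c : ℕ → ℂ) :
    gaussComb n (fun k => a * c k) = a • gaussComb n c := by
  simp only [gaussComb, Finset.smul_sum, smul_smul]

/-- `η_p` is injective on `L²(ℝ)` (bounded with bounded inverse `1 − D_p`). [cite: ConnesConsaniMoscovici2024, Prop. 4.3 (i) §4.2 p. 18 (arXiv chunk p0013:L21)] -/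
theorem semilocalEta_injective : Function.Injective (semilocalEta p) := by
  intro a b h
  exact (semilocalEtaEquiv p).injective (by rwa [semilocalEtaEquiv_apply, semilocalEtaEquiv_apply])

/-- If `η_pG(m, c) = 0` (`c` supported in `k ≤ m`) then `c = 0`, so the `ϑ_S`-image `η_pG(m+1, ϑc)` vanishes too
(`ϑ_S` is well defined on vectors, not just on coefficient sequences).  [cite: ConnesConsaniMoscovici2024, Thm. 4.1 (iii) §4.3 p. 18 (arXiv chunk p0013:L49, proof L52)] -/
theorem semilocalEta_theta_eq_zero {m : ℕ} {c : ℕ → ℂ} (hc : ∀ k, m < k → c k = 0)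
    (h0 : semilocalEta p (gaussComb m c) = 0) :
    semilocalEta p (gaussComb (m + 1) (scalingGenCoeff c)) = 0 := by
  have hG : gaussComb m c = 0 := semilocalEta_injective p (by rw [h0, map_zero])
  have hc0 : ∀ k, c k = 0 := fun k =>
    if hk : k ≤ m then eq_zero_of_gaussComb_eq_zero hG k hk else hc k (not_le.mp hk)
  have hθ : scalingGenCoeff c = fun _ => 0 := by
    funext k; simp [scalingGenCoeff, hc0]
  rw [hθ]
  simp [gaussComb]

/-- **Zero diagonal of the Jacobi matrix**: `⟪ϑ_S u, u⟫ = 0` for a layer vector `u = η_pG(m, c) ∈ E_m^S ⊖ E_{m−1}^S`.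
The printed argument is eq. (6) for the even pair `(ϑ_S, ξ_S)` (grading `γ` with `γϑ_Sγ⁻¹ = −ϑ_S`, Prop. 4.2 (ii)).
Here — a deviation in the tool, not in the statement — the grading is replaced by complex conjugation of the
coefficients: the Gram matrix is real, so `η_pG(m, c̄)` lies in the same layer LINE (Thm. 4.1 (ii), discharged
above), whence `c̄ = λc` with `|λ| = 1`, `conj (ϑc) = −λ·ϑc`, and `z = ⟪ϑ_S u, u⟫` satisfies `z = conj z` (symmetry)
and `conj z = −z`, so `z = 0`.  [cite: ConnesConsaniMoscovici2024, Thm. 4.1 (iii) §4.3 p. 18 (arXiv chunk p0013:L49, proof L52); §2.2 eq. (6) p. 6; Prop. 4.2 (ii) §4.2 p. 18] -/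
theorem inner_semilocalEta_theta_self {m : ℕ} {c : ℕ → ℂ} (hc : ∀ k, m < k → c k = 0)
    (hu : semilocalEta p (gaussComb m c) ∈ semilocalLayer p m) :
    ⟪semilocalEta p (gaussComb (m + 1) (scalingGenCoeff c)), semilocalEta p (gaussComb m c)⟫_ℂ = 0 := by
  by_cases hu0 : semilocalEta p (gaussComb m c) = 0
  · rw [semilocalEta_theta_eq_zero p hc hu0, inner_zero_left]
  -- the Gram matrix entries
  have hr : ∀ j k : ℕ, ⟪semilocalEta p (gaussMonomialVec j), semilocalEta p (gaussMonomialVec k)⟫_ℂ =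
      ⟪semilocalEta p (gaussMonomialVec k), semilocalEta p (gaussMonomialVec j)⟫_ℂ := fun j k => by
    rw [← inner_conj_symm, conj_inner_semilocalEta_gaussMonomialVec]
  -- the conjugate-coefficient vector lies in the same layer
  set cb : ℕ → ℂ := fun k => conj (c k) with hcb
  have hgen : ∀ k, k < m →
      ⟪semilocalEta p (gaussMonomialVec k), semilocalEta p (gaussComb m c)⟫_ℂ = 0 := by
    intro k hk
    have hmem : semilocalEta p (gaussMonomialVec k) ∈ ⨆ (j : ℕ) (_ : j < m), semilocalFiltration p j := by
      rw [iSup_semilocalFiltration_lt]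
      exact Submodule.subset_span ⟨k, hk, rfl⟩
    exact Submodule.inner_right_of_mem_orthogonal hmem (Submodule.mem_inf.1 hu).2
  have hub : semilocalEta p (gaussComb m cb) ∈ semilocalLayer p m := by
    refine Submodule.mem_inf.2 ⟨semilocalEta_gaussComb_mem p m cb, ?_⟩
    have hS : Submodule.span ℂ ((fun k => semilocalEta p (gaussMonomialVec k)) '' Set.Iio m) ≤
        (ℂ ∙ semilocalEta p (gaussComb m cb))ᗮ := by
      refine Submodule.span_le.2 ?_
      rintro _ ⟨k, hk, rfl⟩
      rw [SetLike.mem_coe, Submodule.mem_orthogonal_singleton_iff_inner_right]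
      have h0 := hgen k hk
      rw [semilocalEta_gaussComb, inner_sum] at h0
      rw [semilocalEta_gaussComb, sum_inner]
      simp only [inner_smul_right] at h0
      simp only [inner_smul_left, hcb, Complex.conj_conj]
      rw [← h0]
      exact Finset.sum_congr rfl fun j _ => by rw [hr j k]
    rw [iSup_semilocalFiltration_lt, Submodule.mem_orthogonal]
    intro w hw
    exact inner_eq_zero_symm.mp (Submodule.mem_orthogonal_singleton_iff_inner_right.mp (hS hw))
  -- the layer is a line: `cb = λ c`
  obtain ⟨c₀, -, hline⟩ := ConnesConsaniMoscovici2024_thm_4_1_ii_holds p m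
  have hu' := hu
  rw [hline] at hu' hub
  obtain ⟨b, hb⟩ := Submodule.mem_span_singleton.1 hu'
  obtain ⟨b', hb'⟩ := Submodule.mem_span_singleton.1 hub
  have hb0 : b ≠ 0 := by
    rintro rfl
    exact hu0 (by rw [← hb, zero_smul])
  set lam : ℂ := b' * b⁻¹ with hlam
  have hvec : semilocalEta p (gaussComb m cb) = lam • semilocalEta p (gaussComb m c) := by
    rw [← hb', ← hb, smul_smul, hlam, mul_assoc, inv_mul_cancel₀ hb0, mul_one]
  have hH : ∀ k, conj (c k) = lam * c k := by
    have hG : gaussComb m cb = gaussComb m (fun k => lam * c k) := by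
      refine semilocalEta_injective p ?_
      rw [hvec, gaussComb_smul, map_smul]
    have hG0 : gaussComb m (fun k => cb k - lam * c k) = 0 := by
      rw [← gaussComb_sub, hG, sub_self]
    intro k
    by_cases hk : k ≤ m
    · exact sub_eq_zero.mp (eq_zero_of_gaussComb_eq_zero hG0 k hk)
    · rw [hc k (not_le.mp hk), map_zero, mul_zero]
  -- some coefficient is nonzero, hence `|λ|² = 1`
  have hD : conj lam * lam = 1 := by
    by_contra hne
    apply hu0
    have hc0 : ∀ k, c k = 0 := by
      intro k
      have h1 := hH k
      have h2 := congrArg conj h1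
      rw [Complex.conj_conj, map_mul, h1, ← mul_assoc] at h2
      -- h2 : c k = conj lam * lam * c k
      by_contra hck
      exact hne (mul_right_cancel₀ hck (by rw [← h2, one_mul]))
    have : gaussComb m c = 0 := by
      simp [gaussComb, hc0]
    rw [this, map_zero]
  -- `conj (ϑc)_j = -λ (ϑc)_j`
  have hB : ∀ j, conj (scalingGenCoeff c j) = -lam * scalingGenCoeff c j := by
    intro j
    unfold scalingGenCoeff
    split_ifs with hj
    · simp only [map_mul, map_sub, map_neg, Complex.conj_I, map_add, map_div₀, map_one, map_ofNat,
        map_natCast, Complex.conj_ofReal, map_zero, hH]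
      ring
    · simp only [map_mul, map_sub, map_neg, Complex.conj_I, map_add, map_div₀, map_one, map_ofNat,
        map_natCast, Complex.conj_ofReal, hH]
      ring
  -- `z = conj z` (symmetry) and `conj z = -z` (reality + the relations above)
  set z := ⟪semilocalEta p (gaussComb (m + 1) (scalingGenCoeff c)), semilocalEta p (gaussComb m c)⟫_ℂ
    with hz
  have hA : conj z = z := by
    rw [hz, inner_conj_symm]
    exact (inner_semilocalEta_theta_symm p m m c c (hc _ (Nat.lt_succ_self m))
      (hc _ (Nat.lt_succ_self m))).symm
  have hC : conj z = -(conj lam * lam) * z := by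
    rw [hz, inner_semilocalEta_gaussComb, map_sum, Finset.mul_sum]
    refine Finset.sum_congr rfl fun j _ => ?_
    rw [map_sum, Finset.mul_sum]
    refine Finset.sum_congr rfl fun k _ => ?_
    rw [map_mul, map_mul, Complex.conj_conj, conj_inner_semilocalEta_gaussMonomialVec, hH k]
    have hBj := hB j
    have e : scalingGenCoeff c j = -(conj lam) * conj (scalingGenCoeff c j) := by
      have := congrArg conj hBj
      rw [Complex.conj_conj, map_mul, map_neg] at this
      linear_combination this
    linear_combination
      (lam * c k * ⟪semilocalEta p (gaussMonomialVec j), semilocalEta p (gaussMonomialVec k)⟫_ℂ) * e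
  rw [hD] at hC
  have : z = -z :=
    calc z = conj z := hA.symm
      _ = -1 * z := hC
      _ = -z := by ring
  linear_combination this / 2

/-- **Theorem 4.1 (iii) discharged**: "The matrix of `ϑ_S` in the above orthonormal basis of `L²(X_S)^{K_S}` is a
Jacobi hermitian matrix" — in the pulled-back typing: for a layer-`m` vector `η_pG(m, c)`, its `ϑ_S`-image
`η_pG(m+1, ϑc)` is orthogonal to every layer `n ∉ {m−1, m+1}`.  Proof as printed ("follows from (6), the general
theory of orthogonal polynomials"): `n ≥ m+2` — `ϑ_SE_m^S ⊆ E_{m+1}^S ⊥` layer `n`; `n ≤ m−2` — symmetry of `ϑ_S` on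
the core (`inner_semilocalEta_theta_symm`) moves `ϑ_S` onto the layer-`n` vector, whose image lies in
`E_{n+1}^S ⊥` layer `m`; `n = m` — `inner_semilocalEta_theta_self`.  RH-FREE.
[cite: ConnesConsaniMoscovici2024, Thm. 4.1 (iii) §4.3 p. 18 (arXiv chunk p0013:L49, proof L52); §2.2 eq. (6) p. 6] -/
theorem ConnesConsaniMoscovici2024_thm_4_1_iii_holds : ConnesConsaniMoscovici2024_thm_4_1_iii p := by
  intro m n c hc hu h1 h2 v hv
  rcases Nat.lt_or_ge n m with hnm | hmn
  · -- `n + 2 ≤ m`: move `ϑ` to the right by symmetry; `ϑ v ∈ E_{n+1}^S ⊥ u`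
    have hn2 : n + 1 < m := by omega
    obtain ⟨d, hd, rfl⟩ := exists_eq_semilocalEta_gaussComb p (Submodule.mem_inf.1 hv).1
    rw [inner_semilocalEta_theta_symm p m n c d (hc _ (Nat.lt_succ_self m))
      (hd _ (Nat.lt_succ_self n))]
    have hmem : semilocalEta p (gaussComb (n + 1) (scalingGenCoeff d)) ∈
        ⨆ (k : ℕ) (_ : k < m), semilocalFiltration p k :=
      (le_iSup₂ (f := fun k (_ : k < m) => semilocalFiltration p k) (n + 1) hn2)
        (semilocalEta_gaussComb_mem p (n + 1) _)
    exact Submodule.inner_left_of_mem_orthogonal hmem (Submodule.mem_inf.1 hu).2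
  · rcases hmn.eq_or_lt with heq | hlt
    · -- the diagonal `n = m`
      subst heq
      obtain ⟨c₀, -, hline⟩ := ConnesConsaniMoscovici2024_thm_4_1_ii_holds p m
      have hu' := hu
      have hv' := hv
      rw [hline] at hu' hv'
      obtain ⟨a, ha⟩ := Submodule.mem_span_singleton.1 hv'
      obtain ⟨b, hb⟩ := Submodule.mem_span_singleton.1 hu'
      by_cases hb0 : b = 0
      · rw [hb0, zero_smul] at hb
        rw [semilocalEta_theta_eq_zero p hc hb.symm, inner_zero_left]
      · have hv_eq : v = (a * b⁻¹) • semilocalEta p (gaussComb m c) := by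
          rw [← ha, ← hb, smul_smul, mul_assoc, inv_mul_cancel₀ hb0, mul_one]
        rw [hv_eq, inner_smul_right, inner_semilocalEta_theta_self p hc hu, mul_zero]
    · -- `m + 2 ≤ n`: `ϑ u ∈ E_{m+1}^S ⊥ v`
      have hm2 : m + 1 < n := by omega
      have hmem : semilocalEta p (gaussComb (m + 1) (scalingGenCoeff c)) ∈
          ⨆ (k : ℕ) (_ : k < n), semilocalFiltration p k :=
        (le_iSup₂ (f := fun k (_ : k < n) => semilocalFiltration p k) (m + 1) hm2)
          (semilocalEta_gaussComb_mem p (m + 1) _)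
      exact Submodule.inner_right_of_mem_orthogonal hmem (Submodule.mem_inf.1 hv).2

end JacobiDischarge

end Literature.NumberTheory.ConnesConsani2024
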